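import Literature.MathematicalPhysics.QuantumFieldTheory.O2ThreeScalarCrossing
import Literature.MathematicalPhysics.QuantumFieldTheory.O2ThreeScalarSystem

/-!
# The 22 crossing equations of the `O(2)` three-scalar system DERIVED from crossing symmetry in flavour space
# (Chester–Landry–Liu–Poland–Simmons-Duffin–Su–Vichi 2020, §2.1, App. «Tensor structures», App. «Crossing vectors»;
# Kos–Poland–Simmons-Duffin–Vichi 2015, §2)

Topic `MathematicalPhysics/QuantumFieldTheory`; definitions + theorems only (no named fact, no instance, no axiom
beyond Lean's three, no `sorry`).  A sequel of `O2ThreeScalarCrossing.lean` (imported together with `O2ThreeScalarSystem.lean`,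
whose axiom A3 it discharges in §10), which QUOTES the seven crossing
vectors `V⃗_{0⁺}, V⃗_{0⁻}, V⃗_1, V⃗_{2,ℓ⁺}, V⃗_{2,ℓ⁻}, V⃗_3, V⃗_4` (22 rows each) verbatim from the appendix
«Crossing vectors» and states the crossing equation with them as a hypothesis.  That file and
`O2ThreeScalarCrossingTS.lean` check 13 of the 22 rows against the independently derived KPSV system; the nine
rows of the `⟨ttφφ⟩, ⟨tφtφ⟩, ⟨φttφ⟩` and `⟨φφst⟩, ⟨φsφt⟩, ⟨sφφt⟩` groups stayed quoted.  THIS file derives ALL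
22 rows: it quotes instead the sixteen non-trivial flavour tensor structures `T^R(w_i, w̄_i)` (and `⟨ssss⟩ : 1`) of
the appendix «Tensor structures» (one level closer to first principles), imposes crossing symmetry `(1 ↔ 3)` of each of the
fifteen orderings of Table 1 as an identity between polynomials in the flavour variables on the admissible set
`w_i w̄_i = 0`, extracts coefficients, and proves that (i) the resulting 22 equations are EQUIVALENT to flavoured
crossing symmetry at the point pair `(u,v), (v,u)`, and (ii) for a single exchanged multiplet in each of the seven
sectors the quoted vector of `O2ThreeScalarCrossing` is exactly TWICE the derived one — every entry of every
quoted row is thereby checked by the kernel against the quoted tensor structures and the coupling dictionary; and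
(iii) consequently the crossing-equation hypotheses of the exclusion theorem `false_of_pointFunctional₂₂` of that
file, and axiom A3 `O2Data.SatisfiesCrossing` of `O2ThreeScalarSystem.lean`, are discharged from flavour-space
crossing of the grouped total channel sums (§9, §10).

SOURCE (held text `paper:arxiv-1912.03324`: §2.1 p. 6–7, App. «Tensor structures» p. 20, App. «Crossing
vectors» p. 21–22).  S. M. Chester, W. Landry, J. Liu, D. Poland, D. Simmons-Duffin, N. Su, A. Vichi, *Carving
out OPE space and precise O(2) model critical exponents*, JHEP 06 (2020) 142:
* §2.1, eq. (4point): the `s`-channel expansion of `⟨𝒪¹_{ℛ₁}(x₁,y₁) 𝒪²_{ℛ₂}(x₂,y₂) 𝒪³_{ℛ₃}(x₃,y₃) 𝒪⁴_{ℛ₄}(x₄,y₄)⟩`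
  is a kinematic prefactor times *"`Σ_𝒪 (−1)^ℓ λ_{𝒪₁𝒪₂𝒪} λ_{𝒪₃𝒪₄𝒪} T^{R}_{ℛ₁ℛ₂ℛ₃ℛ₄}(y_i) g^{Δ₁₂,Δ₃₄}_{Δ,ℓ}(u,v)`"*,
  where *"for each `𝒪`, the `O(2)` structure `T^R_{ℛ₁ℛ₂ℛ₃ℛ₄}(y_i)` is a polynomial in `y_i` … that can be
  derived from contracting appropriate 3-point functions as described in appendix [Tensor structures]"*;
  *"Equating each of these `s`-channel 4-point functions with their respective `t`-channels yields the crossing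
  equations `Σ (λ…) V⃗_{0⁺,Δ,ℓ⁺} (λ…)ᵀ + … + Σ λ²_{tt𝒪_4} V⃗_{4,Δ,ℓ⁺} = 0`, where … the `V`'s are 22-dimensional
  vectors of matrix or scalar crossing equations that are ordered as table 1 and written in terms of
  `F^{ij,kl}_{∓,Δ,ℓ}(u,v) = v^{(Δ_k+Δ_j)/2} g^{Δ_ij,Δ_kl}_{Δ,ℓ}(u,v) ∓ u^{(Δ_k+Δ_j)/2} g^{Δ_ij,Δ_kl}_{Δ,ℓ}(v,u)`"*
  [cite: ChesterEtAl2020, §2.1].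
* App. «Tensor structures»: *"The result of these contractions can then be written in terms of the quantities
  `w_i ≡ y_i·e`, `w̄_i ≡ y_i·ē`, which have the properties `y_i·y_i = w_iw̄_i = 0`, `y_i·y_j = w_iw̄_j + w̄_iw_j`,
  `y_i∧y_j = i(w_iw̄_j − w̄_iw_j)`, which imply that `w_i = 0` or `w̄_i = 0` since `y_i² = 0` by definition"*, and
  the structures `⟨φφφφ⟩: T^{0⁺} = (w_iw̄_j + w̄_iw_j)(w_kw̄_l + w̄_kw_l)`, `T^{0⁻} = −(w_iw̄_j − w̄_iw_j)
  (w_kw̄_l − w̄_kw_l)`, `T^{2} = w_iw_jw̄_kw̄_l + w̄_iw̄_jw_kw_l`; `⟨tttt⟩: T^{0⁺} = (w_iw̄_j + w̄_iw_j)²(w_kw̄_l + w̄_kw_l)²`,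
  `T^{0⁻} = −(w_i²w̄_j² − w̄_i²w_j²)(w_k²w̄_l² − w̄_k²w_l²)`, `T^{4} = (w_iw_jw̄_kw̄_l + w̄_iw̄_jw_kw_l)²`;
  `⟨tφtφ⟩, ⟨φttφ⟩: T^{1}_{2_i1_j2_k1_l} = (w_iw̄_j + w̄_iw_j)(w_kw̄_l + w̄_kw_l)(w_iw̄_k + w̄_iw_k)`,
  `T^{3}_{2_i1_j2_k1_l} = w_i²w_jw̄_k²w̄_l + w̄_i²w̄_jw_k²w_l`; `⟨ttφφ⟩: T^{0⁺} = (w_iw̄_j + w̄_iw_j)²(w_kw̄_l + w̄_kw_l)`,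
  `T^{0⁻} = −(w_i²w̄_j² − w̄_i²w_j²)(w_kw̄_l − w̄_kw_l)` (printed with the subscript `2_i1_j2_k1_l`); `⟨ssss⟩: 1`;
  `⟨φsφs⟩, ⟨sφφs⟩: T^{1} = w_iw̄_k + w̄_iw_k`; `⟨tsts⟩, ⟨stts⟩: T^{2} = w_i²w̄_k² + w̄_i²w_k²`; `⟨ttss⟩: T^{0⁺} =
  (w_iw̄_j + w̄_iw_j)²`; `⟨φφss⟩: T^{0⁺} = w_iw̄_j + w̄_iw_j`; `⟨φsφt⟩, ⟨sφφt⟩: T^{1}_{1_i0 1_k2_l} =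
  (w_kw̄_l + w̄_kw_l)(w_iw̄_l + w̄_iw_l)`; `⟨φφst⟩: T^{2}_{1_i1_j0 2_l} = w_l²w̄_jw̄_i + w̄_l²w_jw_i`
  [cite: ChesterEtAl2020, App. «Tensor structures»]; the flavour 3-point structures (eq. before (4point)) are
  symmetric in their two external slots, and (eq. (3sto4)) `T^R_{ℛ₁ℛ₂ℛ₃ℛ₄}` is the contraction of the two.
F. Kos, D. Poland, D. Simmons-Duffin, A. Vichi, *Bootstrapping the O(N) archipelago*, JHEP 11 (2015) 106, §2:
crossing `(1,i) ↔ (3,k)` of a mixed scalar correlator is `v^{(Δ_k+Δ_j)/2} A(u,v) = u^{(Δ_i+Δ_j)/2} B(v,u)` for the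
two channel sums (`ONMixedSumRule.lean`: `MixedCrossingAt`, `mixedCrossingAt_pair_iff`), and
*"`λ_{ij𝒪} = (−1)^ℓ λ_{ji𝒪}`"* (quoted in the header of `ONMixedSumRule.lean`)
[cite: KosPolandSimmonsDuffinVichi2015, §2].

DICTIONARY (the only modelling choices; each is a definition below, and (ii) is what the kernel cross-checks).
(a) A flavour configuration is `c = (w₀,…,w₃, w̄₀,…,w̄₃) ∈ ℝ⁸` (`Flav`), admissible iff `w_iw̄_i = 0` for all
`i` (`Flav.Adm`) — real values suffice since only polynomial identities on this algebraic set are used; the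
crossed ordering `(𝒪₃,𝒪₂,𝒪₁,𝒪₄)` sees `c ∘ (0 2)` (`Flav.swap`).  (b) For each ordering `L` of Table 1 and each
exchanged irrep `R`, `𝒢^L_R(u,v)` is an opaque function (`Sec`, 22 of them) standing for the channel sum
`Σ_{𝒪∈R} (−1)^ℓ λ_{𝒪₁𝒪₂𝒪} λ_{𝒪₃𝒪₄𝒪} g(u,v)`; the flavoured `s`-channel sum is `S_L(c) = Σ_R T^R_L(c) 𝒢^L_R` (`S`),
with the structures of the four orderings not separately printed (`⟨φttφ⟩, ⟨sφφs⟩, ⟨stts⟩, ⟨sφφt⟩`) obtained from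
the printed partner by exchanging positions `0 ↔ 1` (symmetry of the 3-point structures).  (c) Crossing of `L` at
`(u,v)` is `MixedCrossingAt (expo L) (expo L×) (S_L c) (S_{L×} c.swap) u v` for every admissible `c`
(`CrossingAt`, `O2CrossingAt`; `Dims.expo` and `Label` imported).  (d) ONE exchanged multiplet with couplings as in
the source's coupling vectors contributes the channel sums `sec0p a b c g, …, sec4 p g` of §7, in which the factor
`(−1)^ℓ` of eq. (4point) and the mirrored couplings `λ_{sφ𝒪} = (−1)^ℓ λ_{φs𝒪}`, `λ_{φt𝒪} = (−1)^ℓ λ_{tφ𝒪}`,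
`λ_{st𝒪} = (−1)^ℓ λ_{ts𝒪}` are written out (e.g. `𝒢^{sφφs}_1 = λ_{sφ}λ_{φs}(−1)^ℓ g = λ²_{φs} g`).

WHAT IS PROVED.  §5 `derivedVec_eq_zero`: flavoured crossing of the fifteen orderings at `(u,v)` and at `(v,u)`
implies the 22 equations `derivedVec D 𝒢 u v = 0`, obtained as coefficients of flavour monomials (each row's
docstring names its monomial; rows 2, 5 are differences of two coefficient identities).  §6
`o2CrossingAt_iff_derivedVec`: conversely the 22 equations imply flavoured crossing at `(u,v)` and `(v,u)` for ALL
admissible configurations (normal forms of each `S_L` on `w_iw̄_i = 0`, sixteen-case splits) — so the 22 rows are a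
COMPLETE set.  §7: for one multiplet, `quad0p D a b c g u v = 2 • derivedVec D (sec0p a b c g) u v` and likewise
`quad0m`, `quad1`, `quad2p`, `p • V2m`, `p • V3`, `p • V4` (`…_eq_two_smul_derivedVec`): all `7 × 22` quoted
entries, signs `ε = (−1)^ℓ`, factors `2, −4` and weights `λλ'` included, agree with the derivation.  §8:
`derivedVec` is linear and passes termwise through channel-by-channel sums at the two points `(u,v), (v,u)`
(`hasSum_derivedVec`), whence `hasSum_derivedVec_zero`: if the total channel sums are flavour-crossing symmetric at
`(u,v),(v,u)`, the derived vectors of the contributions sum to `0`.  §9 `crossingEq_of_flavourCrossing`: with the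
total channel sums GROUPED as in §3.1–§3.2 (`totalSums` = unit + externals `s, φ, t` with `λ_ext` + seven sector
sums), flavour crossing at `(u,v),(v,u)` yields, sector by sector, convergence of the series of QUOTED crossing
vectors (to twice the derived vector of the sector's channel sums) and the grouped equation
`quad0p D 1 1 1 unitBlocks + λ_extᵀ V⃗_ext λ_ext + Σ_sectors = 0` — exactly the hypotheses `h0p … h4, hx` of
`O2ThreeScalarCrossing.false_of_pointFunctional₂₂`; `false_of_pointFunctional₂₂_of_flavourCrossing` is that
exclusion theorem with those hypotheses discharged: block-expansion data + flavour-space crossing at the evaluation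
points + the §3.1/§3.2 functional conditions ⇒ `False`.  §10 `satisfiesCrossing_of_flavourCrossing`: for a datum
`X : O2Data` of `O2ThreeScalarSystem.lean`, flavour-space crossing with channel-by-channel convergence at every point
`(z z̄, (1−z)(1−z̄))`, `z, z̄ ∈ (0,1)` (`FlavourCrossingAt`, signs `(−1)^ℓ` and weights `λ²` as in eq. (4point))
implies axiom A3 `X.SatisfiesCrossing` — the grouped equation with the QUOTED vectors that `SatisfiesO2Axioms`,
`O2Enclosure` and `BoxExcluded` consume.

HONEST LIMITS.  Crossing symmetry of the physical correlator, the block expansion eq. (4point) and the values of the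
tensor structures are INPUTS (hypotheses / quoted definitions), exactly as the KPSV sum rules are in
`ONMixedSumRule.lean`; what is new is that the 22-row bookkeeping (which orderings, which irreps, which signs and
factors) is no longer trusted but computed; likewise the convergence hypotheses of §9 (channel-by-channel `HasSum` at the
evaluation points) are INPUTS.  Bose selection rules (even/odd spins per sector) are not derived; they
enter only through which single-multiplet records exist.  Nothing here concerns spectra, functionals or numerics.

## References
* S. M. Chester, W. Landry, J. Liu, D. Poland, D. Simmons-Duffin, N. Su, A. Vichi, *Carving out OPE space and
  precise O(2) model critical exponents*, JHEP 06 (2020) 142, arXiv:1912.03324, §2.1 (eq. (4point), Table 1),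
  App. «Tensor structures», App. «Crossing vectors». [cite: ChesterEtAl2020]
* F. Kos, D. Poland, D. Simmons-Duffin, A. Vichi, *Bootstrapping the O(N) archipelago*, JHEP 11 (2015) 106,
  arXiv:1504.07997, §2 (crossing equation; `λ_{ij𝒪} = (−1)^ℓ λ_{ji𝒪}`). [cite: KosPolandSimmonsDuffinVichi2015]
-/

noncomputable section

open Finset Matrix
open Literature.MathematicalPhysics.QuantumFieldTheory.ONVectorSumRule
open Literature.MathematicalPhysics.QuantumFieldTheory.ONMixedSumRule
open Literature.MathematicalPhysics.QuantumFieldTheory.O2ThreeScalarCrossing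

namespace Literature.MathematicalPhysics.QuantumFieldTheory.O2CrossingDerivation

/-! ## 1. Flavour variables and the quoted `O(2)` tensor structures -/

/-- A flavour configuration: the numbers `w_i = y_i·e`, `w̄_i = y_i·ē` of the four external polarisations
(`i = 0,1,2,3` for the four positions of the ordering; `b_i` stands for `w̄_i`).
[cite: ChesterEtAl2020, App. «Tensor structures» (`w_i ≡ y_i·e`, `w̄_i ≡ y_i·ē`)] -/
structure Flav where
  /-- `w₀ = y₁·e`. -/
  w0 : ℝ
  /-- `w₁ = y₂·e`. -/
  w1 : ℝ
  /-- `w₂ = y₃·e`. -/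
  w2 : ℝ
  /-- `w₃ = y₄·e`. -/
  w3 : ℝ
  /-- `w̄₀ = y₁·ē`. -/
  b0 : ℝ
  /-- `w̄₁ = y₂·ē`. -/
  b1 : ℝ
  /-- `w̄₂ = y₃·ē`. -/
  b2 : ℝ
  /-- `w̄₃ = y₄·ē`. -/
  b3 : ℝ

namespace Flav

/-- Admissible configurations: `w_i w̄_i = y_i · y_i = 0` at every position ("which imply that `w_i = 0` or
`w̄_i = 0` since `y_i² = 0` by definition"). [cite: ChesterEtAl2020, App. «Tensor structures» (`y_i·y_i = w_iw̄_i = 0`)] -/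
def Adm (c : Flav) : Prop := c.w0 * c.b0 = 0 ∧ c.w1 * c.b1 = 0 ∧ c.w2 * c.b2 = 0 ∧ c.w3 * c.b3 = 0

/-- The configuration seen by the crossed correlator: positions `1 ↔ 3` exchanged (0-based `0 ↔ 2`).
[cite: KosPolandSimmonsDuffinVichi2015, §2 (crossing `(1,i) ↔ (3,k)`)] -/
def swap (c : Flav) : Flav := ⟨c.w2, c.w1, c.w0, c.w3, c.b2, c.b1, c.b0, c.b3⟩

/-- Component of the crossed configuration (by definition). [folklore] -/
@[simp] private theorem swap_w0 (c : Flav) : c.swap.w0 = c.w2 := rfl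
/-- Component of the crossed configuration (by definition). [folklore] -/
@[simp] private theorem swap_w1 (c : Flav) : c.swap.w1 = c.w1 := rfl
/-- Component of the crossed configuration (by definition). [folklore] -/
@[simp] private theorem swap_w2 (c : Flav) : c.swap.w2 = c.w0 := rfl
/-- Component of the crossed configuration (by definition). [folklore] -/
@[simp] private theorem swap_w3 (c : Flav) : c.swap.w3 = c.w3 := rfl
/-- Component of the crossed configuration (by definition). [folklore] -/
@[simp] private theorem swap_b0 (c : Flav) : c.swap.b0 = c.b2 := rfl
/-- Component of the crossed configuration (by definition). [folklore] -/
@[simp] private theorem swap_b1 (c : Flav) : c.swap.b1 = c.b1 := rfl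
/-- Component of the crossed configuration (by definition). [folklore] -/
@[simp] private theorem swap_b2 (c : Flav) : c.swap.b2 = c.b0 := rfl
/-- Component of the crossed configuration (by definition). [folklore] -/
@[simp] private theorem swap_b3 (c : Flav) : c.swap.b3 = c.b3 := rfl

/-- Admissibility is invariant under the position exchange `0 ↔ 2`. [folklore] -/
private theorem Adm.swap {c : Flav} (h : c.Adm) : c.swap.Adm := ⟨h.2.2.1, h.2.1, h.1, h.2.2.2⟩

end Flav

section Structures
variable (c : Flav)

/-- `⟨φφφφ⟩`: `T^{0⁺} = (w₀w̄₁ + w̄₀w₁)(w₂w̄₃ + w̄₂w₃)`. [cite: ChesterEtAl2020, App. «Tensor structures» (`⟨φφφφ⟩`)] -/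
def Tφφφφ0p : ℝ := (c.w0 * c.b1 + c.b0 * c.w1) * (c.w2 * c.b3 + c.b2 * c.w3)
/-- `⟨φφφφ⟩`: `T^{0⁻} = −(w₀w̄₁ − w̄₀w₁)(w₂w̄₃ − w̄₂w₃)`. [cite: ChesterEtAl2020, App. «Tensor structures» (`⟨φφφφ⟩`)] -/
def Tφφφφ0m : ℝ := -((c.w0 * c.b1 - c.b0 * c.w1) * (c.w2 * c.b3 - c.b2 * c.w3))
/-- `⟨φφφφ⟩`: `T^{2} = w₀w₁w̄₂w̄₃ + w̄₀w̄₁w₂w₃`. [cite: ChesterEtAl2020, App. «Tensor structures» (`⟨φφφφ⟩`)] -/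
def Tφφφφ2 : ℝ := c.w0 * c.w1 * c.b2 * c.b3 + c.b0 * c.b1 * c.w2 * c.w3
/-- `⟨tttt⟩`: `T^{0⁺} = (w₀w̄₁ + w̄₀w₁)²(w₂w̄₃ + w̄₂w₃)²`. [cite: ChesterEtAl2020, App. «Tensor structures» (`⟨tttt⟩`)] -/
def Ttttt0p : ℝ := (c.w0 * c.b1 + c.b0 * c.w1) ^ 2 * (c.w2 * c.b3 + c.b2 * c.w3) ^ 2
/-- `⟨tttt⟩`: `T^{0⁻} = −(w₀²w̄₁² − w̄₀²w₁²)(w₂²w̄₃² − w̄₂²w₃²)`. [cite: ChesterEtAl2020, App. «Tensor structures» (`⟨tttt⟩`)] -/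
def Ttttt0m : ℝ :=
  -((c.w0 ^ 2 * c.b1 ^ 2 - c.b0 ^ 2 * c.w1 ^ 2) * (c.w2 ^ 2 * c.b3 ^ 2 - c.b2 ^ 2 * c.w3 ^ 2))
/-- `⟨tttt⟩`: `T^{4} = (w₀w₁w̄₂w̄₃ + w̄₀w̄₁w₂w₃)²`. [cite: ChesterEtAl2020, App. «Tensor structures» (`⟨tttt⟩`)] -/
def Ttttt4 : ℝ := (c.w0 * c.w1 * c.b2 * c.b3 + c.b0 * c.b1 * c.w2 * c.w3) ^ 2
/-- `⟨tφtφ⟩`: `T^{1}_{2₀1₁2₂1₃} = (w₀w̄₁ + w̄₀w₁)(w₂w̄₃ + w̄₂w₃)(w₀w̄₂ + w̄₀w₂)`.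
[cite: ChesterEtAl2020, App. «Tensor structures» (`⟨tφtφ⟩, ⟨φttφ⟩`)] -/
def Ttφtφ1 : ℝ :=
  (c.w0 * c.b1 + c.b0 * c.w1) * (c.w2 * c.b3 + c.b2 * c.w3) * (c.w0 * c.b2 + c.b0 * c.w2)
/-- `⟨tφtφ⟩`: `T^{3}_{2₀1₁2₂1₃} = w₀²w₁w̄₂²w̄₃ + w̄₀²w̄₁w₂²w₃`. [cite: ChesterEtAl2020, App. «Tensor structures» (`⟨tφtφ⟩, ⟨φttφ⟩`)] -/
def Ttφtφ3 : ℝ := c.w0 ^ 2 * c.w1 * c.b2 ^ 2 * c.b3 + c.b0 ^ 2 * c.b1 * c.w2 ^ 2 * c.w3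
/-- `⟨φttφ⟩`: the `⟨tφtφ⟩` structures with the first two positions exchanged (DICTIONARY, see the module
docstring): `T^{1}_{1₀2₁2₂1₃} = (w₁w̄₀ + w̄₁w₀)(w₂w̄₃ + w̄₂w₃)(w₁w̄₂ + w̄₁w₂)`.
[cite: ChesterEtAl2020, App. «Tensor structures» (`⟨tφtφ⟩, ⟨φttφ⟩`; eq. (3sto4))] -/
def Tφttφ1 : ℝ :=
  (c.w1 * c.b0 + c.b1 * c.w0) * (c.w2 * c.b3 + c.b2 * c.w3) * (c.w1 * c.b2 + c.b1 * c.w2)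
/-- `⟨φttφ⟩`: `T^{3}_{1₀2₁2₂1₃} = w₁²w₀w̄₂²w̄₃ + w̄₁²w̄₀w₂²w₃` (positions exchanged).
[cite: ChesterEtAl2020, App. «Tensor structures» (`⟨tφtφ⟩, ⟨φttφ⟩`)] -/
def Tφttφ3 : ℝ := c.w1 ^ 2 * c.w0 * c.b2 ^ 2 * c.b3 + c.b1 ^ 2 * c.b0 * c.w2 ^ 2 * c.w3
/-- `⟨ttφφ⟩`: `T^{0⁺} = (w₀w̄₁ + w̄₀w₁)²(w₂w̄₃ + w̄₂w₃)`. [cite: ChesterEtAl2020, App. «Tensor structures» (`⟨ttφφ⟩`)] -/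
def Tttφφ0p : ℝ := (c.w0 * c.b1 + c.b0 * c.w1) ^ 2 * (c.w2 * c.b3 + c.b2 * c.w3)
/-- `⟨ttφφ⟩`: `T^{0⁻} = −(w₀²w̄₁² − w̄₀²w₁²)(w₂w̄₃ − w̄₂w₃)` (printed with the subscript `2ᵢ1ⱼ2ₖ1ₗ`; the formula
is the `⟨ttφφ⟩` one). [cite: ChesterEtAl2020, App. «Tensor structures» (`⟨ttφφ⟩`)] -/
def Tttφφ0m : ℝ := -((c.w0 ^ 2 * c.b1 ^ 2 - c.b0 ^ 2 * c.w1 ^ 2) * (c.w2 * c.b3 - c.b2 * c.w3))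
/-- `⟨φsφs⟩`: `T^{1}_{1₀0₁1₂0₃} = w₀w̄₂ + w̄₀w₂`. [cite: ChesterEtAl2020, App. «Tensor structures» (`⟨φsφs⟩, ⟨sφφs⟩`)] -/
def Tφsφs1 : ℝ := c.w0 * c.b2 + c.b0 * c.w2
/-- `⟨sφφs⟩` (positions exchanged): `T^{1}_{0₀1₁1₂0₃} = w₁w̄₂ + w̄₁w₂`.
[cite: ChesterEtAl2020, App. «Tensor structures» (`⟨φsφs⟩, ⟨sφφs⟩`)] -/
def Tsφφs1 : ℝ := c.w1 * c.b2 + c.b1 * c.w2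
/-- `⟨tsts⟩`: `T^{2}_{2₀0₁2₂0₃} = w₀²w̄₂² + w̄₀²w₂²`. [cite: ChesterEtAl2020, App. «Tensor structures» (`⟨tsts⟩, ⟨stts⟩`)] -/
def Ttsts2 : ℝ := c.w0 ^ 2 * c.b2 ^ 2 + c.b0 ^ 2 * c.w2 ^ 2
/-- `⟨stts⟩` (positions exchanged): `T^{2}_{0₀2₁2₂0₃} = w₁²w̄₂² + w̄₁²w₂²`.
[cite: ChesterEtAl2020, App. «Tensor structures» (`⟨tsts⟩, ⟨stts⟩`)] -/
def Tstts2 : ℝ := c.w1 ^ 2 * c.b2 ^ 2 + c.b1 ^ 2 * c.w2 ^ 2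
/-- `⟨ttss⟩`: `T^{0⁺} = (w₀w̄₁ + w̄₀w₁)²`. [cite: ChesterEtAl2020, App. «Tensor structures» (`⟨ttss⟩`)] -/
def Tttss0p : ℝ := (c.w0 * c.b1 + c.b0 * c.w1) ^ 2
/-- `⟨φφss⟩`: `T^{0⁺} = w₀w̄₁ + w̄₀w₁`. [cite: ChesterEtAl2020, App. «Tensor structures» (`⟨φφss⟩`)] -/
def Tφφss0p : ℝ := c.w0 * c.b1 + c.b0 * c.w1
/-- `⟨φsφt⟩`: `T^{1}_{1₀0₁1₂2₃} = (w₂w̄₃ + w̄₂w₃)(w₀w̄₃ + w̄₀w₃)`. [cite: ChesterEtAl2020, App. «Tensor structures» (`⟨φsφt⟩, ⟨sφφt⟩`)] -/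
def Tφsφt1 : ℝ := (c.w2 * c.b3 + c.b2 * c.w3) * (c.w0 * c.b3 + c.b0 * c.w3)
/-- `⟨sφφt⟩` (positions exchanged): `T^{1}_{0₀1₁1₂2₃} = (w₂w̄₃ + w̄₂w₃)(w₁w̄₃ + w̄₁w₃)`.
[cite: ChesterEtAl2020, App. «Tensor structures» (`⟨φsφt⟩, ⟨sφφt⟩`)] -/
def Tsφφt1 : ℝ := (c.w2 * c.b3 + c.b2 * c.w3) * (c.w1 * c.b3 + c.b1 * c.w3)
/-- `⟨φφst⟩`: `T^{2}_{1₀1₁0₂2₃} = w₃²w̄₁w̄₀ + w̄₃²w₁w₀`. [cite: ChesterEtAl2020, App. «Tensor structures» (`⟨φφst⟩`)] -/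
def Tφφst2 : ℝ := c.w3 ^ 2 * c.b1 * c.b0 + c.b3 ^ 2 * c.w1 * c.w0

end Structures

/-! ## 2. The flavoured `s`-channel sums of the fifteen orderings -/

/-- The 22 (ordering, exchanged irrep) pairs of the system — the index of the channel sums
`𝒢^{L}_{R}(u,v) = Σ_{𝒪 ∈ R} (−1)^ℓ λ_{𝒪₁𝒪₂𝒪} λ_{𝒪₃𝒪₄𝒪} g_𝒪(u,v)`.
[cite: ChesterEtAl2020, §2.1 (Table 1: orderings and exchanged irreps)] -/
inductive Sec
  | φφφφ0p | φφφφ0m | φφφφ2 | tttt0p | tttt0m | tttt4 | ssss0p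
  | φφss0p | sφφs1 | φsφs1 | ttss0p | stts2 | tsts2
  | ttφφ0p | ttφφ0m | φttφ1 | φttφ3 | tφtφ1 | tφtφ3
  | φφst2 | sφφt1 | φsφt1

/-- The flavoured `s`-channel sum of each ordering `L`: `S_L(u,v; w) = Σ_R T^R_L(w) 𝒢^L_R(u,v)`.
[cite: ChesterEtAl2020, §2.1 (eq. (4point))] -/
def S (G : Sec → ℝ → ℝ → ℝ) : Label → Flav → ℝ → ℝ → ℝ
  | .φφφφ, c, u, v => Tφφφφ0p c * G .φφφφ0p u v + Tφφφφ0m c * G .φφφφ0m u v + Tφφφφ2 c * G .φφφφ2 u v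
  | .tttt, c, u, v => Ttttt0p c * G .tttt0p u v + Ttttt0m c * G .tttt0m u v + Ttttt4 c * G .tttt4 u v
  | .ssss, _, u, v => G .ssss0p u v
  | .φφss, c, u, v => Tφφss0p c * G .φφss0p u v
  | .sφφs, c, u, v => Tsφφs1 c * G .sφφs1 u v
  | .φsφs, c, u, v => Tφsφs1 c * G .φsφs1 u v
  | .ttss, c, u, v => Tttss0p c * G .ttss0p u v
  | .stts, c, u, v => Tstts2 c * G .stts2 u v
  | .tsts, c, u, v => Ttsts2 c * G .tsts2 u v
  | .ttφφ, c, u, v => Tttφφ0p c * G .ttφφ0p u v + Tttφφ0m c * G .ttφφ0m u v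
  | .φttφ, c, u, v => Tφttφ1 c * G .φttφ1 u v + Tφttφ3 c * G .φttφ3 u v
  | .tφtφ, c, u, v => Ttφtφ1 c * G .tφtφ1 u v + Ttφtφ3 c * G .tφtφ3 u v
  | .φφst, c, u, v => Tφφst2 c * G .φφst2 u v
  | .sφφt, c, u, v => Tsφφt1 c * G .sφφt1 u v
  | .φsφt, c, u, v => Tφsφt1 c * G .φsφt1 u v

/-- The crossed ordering `(𝒪₃, 𝒪₂, 𝒪₁, 𝒪₄)` of each ordering.
[cite: KosPolandSimmonsDuffinVichi2015, §2 (crossing `(1,i) ↔ (3,k)`)] -/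
def cross : Label → Label
  | .φφφφ => .φφφφ | .tttt => .tttt | .ssss => .ssss
  | .φφss => .sφφs | .sφφs => .φφss | .φsφs => .φsφs
  | .ttss => .stts | .stts => .ttss | .tsts => .tsts
  | .ttφφ => .φttφ | .φttφ => .ttφφ | .tφtφ => .tφtφ
  | .φφst => .sφφt | .sφφt => .φφst | .φsφt => .φsφt

/-! ## 3. Crossing symmetry in flavour space -/

/-- Crossing symmetry of the ordering `L` at `(u,v)`: for every admissible flavour configuration,
`v^{(Δ₂+Δ₃)/2} S_L(u,v; w) = u^{(Δ₁+Δ₂)/2} S_{L×}(v,u; w∘(1 3))` — the imported `MixedCrossingAt` with the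
exponents `D.expo L = (Δ₂+Δ₃)/2` and `D.expo (cross L) = (Δ₁+Δ₂)/2`.
[cite: KosPolandSimmonsDuffinVichi2015, §2 (crossing equation)] [cite: ChesterEtAl2020, §2.1 (eq. (4point))] -/
def CrossingAt (D : Dims) (G : Sec → ℝ → ℝ → ℝ) (L : Label) (u v : ℝ) : Prop :=
  ∀ c : Flav, c.Adm → MixedCrossingAt (D.expo L) (D.expo (cross L)) (S G L c) (S G (cross L) c.swap) u v

/-- Crossing symmetry of all fifteen orderings at `(u,v)`. [cite: ChesterEtAl2020, §2.1 (Table 1)] -/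
def O2CrossingAt (D : Dims) (G : Sec → ℝ → ℝ → ℝ) (u v : ℝ) : Prop := ∀ L, CrossingAt D G L u v

/-! ## 4. The 22 derived rows -/

/-- The 22 derived crossing equations at `(u,v)`, in the row order of the source's Table 1 / appendix
«Crossing vectors» (see the module docstring for the flavour monomial each row is the coefficient of).
[cite: ChesterEtAl2020, App. «Crossing vectors» (row order)] -/
def derivedVec (D : Dims) (G : Sec → ℝ → ℝ → ℝ) (u v : ℝ) : Fin 22 → ℝ :=
  ![Fm D.Δφ (G .φφφφ0p - G .φφφφ0m) u v,
    Fm D.Δφ (G .φφφφ2) u v + 2 * Fm D.Δφ (G .φφφφ0m) u v,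
    Fp D.Δφ (G .φφφφ2) u v - Fp D.Δφ (G .φφφφ0p + G .φφφφ0m) u v,
    Fm D.Δt (G .tttt0p - G .tttt0m) u v,
    Fm D.Δt (G .tttt4) u v + 2 * Fm D.Δt (G .tttt0m) u v,
    Fp D.Δt (G .tttt4) u v - Fp D.Δt (G .tttt0p + G .tttt0m) u v,
    Fm ((D.Δφ + D.Δt) / 2) (G .tφtφ1 + G .tφtφ3) u v,
    Fp ((D.Δφ + D.Δt) / 2) (G .tφtφ1) u v - Fp ((D.Δφ + D.Δt) / 2) (G .tφtφ3) u v,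
    Fm ((D.Δφ + D.Δt) / 2) (G .ttφφ0p + G .ttφφ0m) u v + Fm D.Δt (G .φttφ3) u v,
    Fm ((D.Δφ + D.Δt) / 2) (G .ttφφ0p - G .ttφφ0m) u v + Fm D.Δt (G .φttφ1) u v,
    Fp D.Δt (G .φttφ3) u v - Fp ((D.Δφ + D.Δt) / 2) (G .ttφφ0p + G .ttφφ0m) u v,
    Fp D.Δt (G .φttφ1) u v - Fp ((D.Δφ + D.Δt) / 2) (G .ttφφ0p - G .ttφφ0m) u v,
    Fm D.Δs (G .ssss0p) u v,
    Fm ((D.Δφ + D.Δs) / 2) (G .φsφs1) u v,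
    Fm ((D.Δs + D.Δt) / 2) (G .tsts2) u v,
    Fm ((D.Δs + D.Δt) / 2) (G .ttss0p) u v + Fm D.Δt (G .stts2) u v,
    Fp ((D.Δs + D.Δt) / 2) (G .ttss0p) u v - Fp D.Δt (G .stts2) u v,
    Fm ((D.Δφ + D.Δs) / 2) (G .φφss0p) u v + Fm D.Δφ (G .sφφs1) u v,
    Fp ((D.Δφ + D.Δs) / 2) (G .φφss0p) u v - Fp D.Δφ (G .sφφs1) u v,
    Fm ((D.Δφ + D.Δs) / 2) (G .φsφt1) u v,
    Fm ((D.Δφ + D.Δs) / 2) (G .φφst2) u v + Fm D.Δφ (G .sφφt1) u v,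
    Fp D.Δφ (G .sφφt1) u v - Fp ((D.Δφ + D.Δs) / 2) (G .φφst2) u v]

/-! ## 5. Crossing symmetry ⟹ the 22 derived equations (coefficient extraction at `0/1` configurations) -/

section Forward

/-- The configuration `w₀ = w₂ = 1`, `w̄₁ = w̄₃ = 1` (monomial `w₀w̄₁w₂w̄₃`); self-crossed. [folklore] -/
private def cA : Flav := ⟨1, 0, 1, 0, 0, 1, 0, 1⟩
/-- The configuration `w₀ = w₁ = 1`, `w̄₂ = w̄₃ = 1` (monomial `w₀w₁w̄₂w̄₃`). [folklore] -/
private def cB : Flav := ⟨1, 1, 0, 0, 0, 0, 1, 1⟩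
/-- The configuration `w₀ = w₃ = 1`, `w̄₁ = w̄₂ = 1` (monomial `w₀²w̄₁w̄₂²w₃` of `⟨tφtφ⟩`). [folklore] -/
private def cC : Flav := ⟨1, 0, 0, 1, 0, 1, 1, 0⟩
/-- The configuration `w₀ = 1`, `w̄₂ = 1`. [folklore] -/
private def cE : Flav := ⟨1, 0, 0, 0, 0, 0, 1, 0⟩
/-- The configuration `w₀ = 1`, `w̄₁ = 1`. [folklore] -/
private def cF : Flav := ⟨1, 0, 0, 0, 0, 1, 0, 0⟩
/-- The configuration `w₀ = w₂ = 1`, `w̄₃ = 1`; self-crossed. [folklore] -/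
private def cG : Flav := ⟨1, 0, 1, 0, 0, 0, 0, 1⟩
/-- The configuration `w₃ = 1`, `w̄₀ = w̄₁ = 1`. [folklore] -/
private def cH : Flav := ⟨0, 0, 0, 1, 1, 1, 0, 0⟩

/-- The `0/1` configuration is admissible. [folklore] -/
private theorem adm_cA : cA.Adm := by simp [Flav.Adm, cA]
/-- The `0/1` configuration is admissible. [folklore] -/
private theorem adm_cB : cB.Adm := by simp [Flav.Adm, cB]
/-- The `0/1` configuration is admissible. [folklore] -/
private theorem adm_cC : cC.Adm := by simp [Flav.Adm, cC]
/-- The `0/1` configuration is admissible. [folklore] -/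
private theorem adm_cE : cE.Adm := by simp [Flav.Adm, cE]
/-- The `0/1` configuration is admissible. [folklore] -/
private theorem adm_cF : cF.Adm := by simp [Flav.Adm, cF]
/-- The `0/1` configuration is admissible. [folklore] -/
private theorem adm_cG : cG.Adm := by simp [Flav.Adm, cG]
/-- The `0/1` configuration is admissible. [folklore] -/
private theorem adm_cH : cH.Adm := by simp [Flav.Adm, cH]

/-- The configuration is self-crossed. [folklore] -/
private theorem cA_swap : cA.swap = cA := rfl
/-- The configuration is self-crossed. [folklore] -/
private theorem cG_swap : cG.swap = cG := rfl

variable (G : Sec → ℝ → ℝ → ℝ)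

/-- Evaluation of a flavoured channel sum at a `0/1` configuration (plumbing for §5). [folklore] -/
private theorem S_φφφφ_cA : S G .φφφφ cA = G .φφφφ0p - G .φφφφ0m := by
  funext x y; simp only [S, cA, Tφφφφ0p, Tφφφφ0m, Tφφφφ2, Pi.sub_apply]; ring
/-- Evaluation of a flavoured channel sum at a `0/1` configuration (plumbing for §5). [folklore] -/
private theorem S_φφφφ_cB : S G .φφφφ cB = G .φφφφ2 := by
  funext x y; simp only [S, cB, Tφφφφ0p, Tφφφφ0m, Tφφφφ2]; ring
/-- Evaluation of a flavoured channel sum at a `0/1` configuration (plumbing for §5). [folklore] -/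
private theorem S_φφφφ_cBs : S G .φφφφ cB.swap = G .φφφφ0p + G .φφφφ0m := by
  funext x y; simp only [S, cB, Flav.swap, Tφφφφ0p, Tφφφφ0m, Tφφφφ2, Pi.add_apply]; ring
/-- Evaluation of a flavoured channel sum at a `0/1` configuration (plumbing for §5). [folklore] -/
private theorem S_tttt_cA : S G .tttt cA = G .tttt0p - G .tttt0m := by
  funext x y; simp only [S, cA, Ttttt0p, Ttttt0m, Ttttt4, Pi.sub_apply]; ring
/-- Evaluation of a flavoured channel sum at a `0/1` configuration (plumbing for §5). [folklore] -/
private theorem S_tttt_cB : S G .tttt cB = G .tttt4 := by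
  funext x y; simp only [S, cB, Ttttt0p, Ttttt0m, Ttttt4]; ring
/-- Evaluation of a flavoured channel sum at a `0/1` configuration (plumbing for §5). [folklore] -/
private theorem S_tttt_cBs : S G .tttt cB.swap = G .tttt0p + G .tttt0m := by
  funext x y; simp only [S, cB, Flav.swap, Ttttt0p, Ttttt0m, Ttttt4, Pi.add_apply]; ring
/-- Evaluation of a flavoured channel sum at a `0/1` configuration (plumbing for §5). [folklore] -/
private theorem S_tφtφ_cC : S G .tφtφ cC = G .tφtφ1 := by
  funext x y; simp only [S, cC, Ttφtφ1, Ttφtφ3]; ring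
/-- Evaluation of a flavoured channel sum at a `0/1` configuration (plumbing for §5). [folklore] -/
private theorem S_tφtφ_cCs : S G .tφtφ cC.swap = G .tφtφ3 := by
  funext x y; simp only [S, cC, Flav.swap, Ttφtφ1, Ttφtφ3]; ring
/-- Evaluation of a flavoured channel sum at a `0/1` configuration (plumbing for §5). [folklore] -/
private theorem S_ttφφ_cC : S G .ttφφ cC = G .ttφφ0p + G .ttφφ0m := by
  funext x y; simp only [S, cC, Tttφφ0p, Tttφφ0m, Pi.add_apply]; ring
/-- Evaluation of a flavoured channel sum at a `0/1` configuration (plumbing for §5). [folklore] -/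
private theorem S_φttφ_cCs : S G .φttφ cC.swap = G .φttφ3 := by
  funext x y; simp only [S, cC, Flav.swap, Tφttφ1, Tφttφ3]; ring
/-- Evaluation of a flavoured channel sum at a `0/1` configuration (plumbing for §5). [folklore] -/
private theorem S_ttφφ_cA : S G .ttφφ cA = G .ttφφ0p - G .ttφφ0m := by
  funext x y; simp only [S, cA, Tttφφ0p, Tttφφ0m, Pi.sub_apply]; ring
/-- Evaluation of a flavoured channel sum at a `0/1` configuration (plumbing for §5). [folklore] -/
private theorem S_φttφ_cA : S G .φttφ cA = G .φttφ1 := by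
  funext x y; simp only [S, cA, Tφttφ1, Tφttφ3]; ring
/-- Evaluation of a flavoured channel sum at a `0/1` configuration (plumbing for §5). [folklore] -/
private theorem S_ssss (c : Flav) : S G .ssss c = G .ssss0p := by
  funext x y; simp only [S]
/-- Evaluation of a flavoured channel sum at a `0/1` configuration (plumbing for §5). [folklore] -/
private theorem S_φsφs_cE : S G .φsφs cE = G .φsφs1 := by
  funext x y; simp only [S, cE, Tφsφs1]; ring
/-- Evaluation of a flavoured channel sum at a `0/1` configuration (plumbing for §5). [folklore] -/
private theorem S_φsφs_cEs : S G .φsφs cE.swap = G .φsφs1 := by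
  funext x y; simp only [S, cE, Flav.swap, Tφsφs1]; ring
/-- Evaluation of a flavoured channel sum at a `0/1` configuration (plumbing for §5). [folklore] -/
private theorem S_tsts_cE : S G .tsts cE = G .tsts2 := by
  funext x y; simp only [S, cE, Ttsts2]; ring
/-- Evaluation of a flavoured channel sum at a `0/1` configuration (plumbing for §5). [folklore] -/
private theorem S_tsts_cEs : S G .tsts cE.swap = G .tsts2 := by
  funext x y; simp only [S, cE, Flav.swap, Ttsts2]; ring
/-- Evaluation of a flavoured channel sum at a `0/1` configuration (plumbing for §5). [folklore] -/
private theorem S_ttss_cF : S G .ttss cF = G .ttss0p := by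
  funext x y; simp only [S, cF, Tttss0p]; ring
/-- Evaluation of a flavoured channel sum at a `0/1` configuration (plumbing for §5). [folklore] -/
private theorem S_stts_cFs : S G .stts cF.swap = G .stts2 := by
  funext x y; simp only [S, cF, Flav.swap, Tstts2]; ring
/-- Evaluation of a flavoured channel sum at a `0/1` configuration (plumbing for §5). [folklore] -/
private theorem S_φφss_cF : S G .φφss cF = G .φφss0p := by
  funext x y; simp only [S, cF, Tφφss0p]; ring
/-- Evaluation of a flavoured channel sum at a `0/1` configuration (plumbing for §5). [folklore] -/
private theorem S_sφφs_cFs : S G .sφφs cF.swap = G .sφφs1 := by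
  funext x y; simp only [S, cF, Flav.swap, Tsφφs1]; ring
/-- Evaluation of a flavoured channel sum at a `0/1` configuration (plumbing for §5). [folklore] -/
private theorem S_φsφt_cG : S G .φsφt cG = G .φsφt1 := by
  funext x y; simp only [S, cG, Tφsφt1]; ring
/-- Evaluation of a flavoured channel sum at a `0/1` configuration (plumbing for §5). [folklore] -/
private theorem S_φφst_cH : S G .φφst cH = G .φφst2 := by
  funext x y; simp only [S, cH, Tφφst2]; ring
/-- Evaluation of a flavoured channel sum at a `0/1` configuration (plumbing for §5). [folklore] -/
private theorem S_sφφt_cHs : S G .sφφt cH.swap = G .sφφt1 := by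
  funext x y; simp only [S, cH, Flav.swap, Tsφφt1]; ring

variable {G} {D : Dims} {u v : ℝ}

/-- Crossing at `(u,v)` and at `(v,u)` for an ordering and an admissible configuration IS the KPSV pair
`F_-[S_L] + F_-[S_{L×}] = 0`, `F_+[S_L] − F_+[S_{L×}] = 0`. [cite: KosPolandSimmonsDuffinVichi2015, §2 (`F^{ij,kl}_∓`)] -/
theorem pair_of_crossing (h : O2CrossingAt D G u v) (h' : O2CrossingAt D G v u) (L : Label) {c : Flav}
    (hc : c.Adm) :
    Fm (D.expo L) (S G L c) u v + Fm (D.expo (cross L)) (S G (cross L) c.swap) u v = 0 ∧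
      Fp (D.expo L) (S G L c) u v - Fp (D.expo (cross L)) (S G (cross L) c.swap) u v = 0 :=
  (mixedCrossingAt_pair_iff _ _ _ _ _ _).1 ⟨h L c hc, h' L c hc⟩

/-- Row 1: `⟨φφφφ⟩`, monomial `w₀w̄₁w₂w̄₃` (self-crossed), `F_-`. [cite: ChesterEtAl2020, App. «Crossing vectors» (row 1)] -/
theorem derived_row0 (h : O2CrossingAt D G u v) (h' : O2CrossingAt D G v u) :
    Fm D.Δφ (G .φφφφ0p - G .φφφφ0m) u v = 0 := by
  have e := (pair_of_crossing h h' .φφφφ adm_cA).1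
  simp only [cross, Dims.expo, cA_swap, S_φφφφ_cA] at e
  simp only [Fm, Pi.sub_apply] at e ⊢
  linear_combination e / 2

/-- Row 2: `⟨φφφφ⟩`, monomial `w₀w₁w̄₂w̄₃ ↔ w̄₀w₁w₂w̄₃`, `F_-`, minus row 1. [cite: ChesterEtAl2020, App. «Crossing vectors» (row 2)] -/
theorem derived_row1 (h : O2CrossingAt D G u v) (h' : O2CrossingAt D G v u) :
    Fm D.Δφ (G .φφφφ2) u v + 2 * Fm D.Δφ (G .φφφφ0m) u v = 0 := by
  have e := (pair_of_crossing h h' .φφφφ adm_cB).1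
  have e0 := derived_row0 h h'
  simp only [cross, Dims.expo, S_φφφφ_cB, S_φφφφ_cBs] at e
  simp only [Fm, Pi.add_apply, Pi.sub_apply] at e e0 ⊢
  linear_combination e - e0

/-- Row 3: `⟨φφφφ⟩`, monomial `w₀w₁w̄₂w̄₃ ↔ w̄₀w₁w₂w̄₃`, `F_+`. [cite: ChesterEtAl2020, App. «Crossing vectors» (row 3)] -/
theorem derived_row2 (h : O2CrossingAt D G u v) (h' : O2CrossingAt D G v u) :
    Fp D.Δφ (G .φφφφ2) u v - Fp D.Δφ (G .φφφφ0p + G .φφφφ0m) u v = 0 := by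
  have e := (pair_of_crossing h h' .φφφφ adm_cB).2
  simp only [cross, Dims.expo, S_φφφφ_cB, S_φφφφ_cBs] at e
  simp only [Fp, Pi.add_apply] at e ⊢
  linear_combination e

/-- Row 4: `⟨tttt⟩`, monomial `w₀²w̄₁²w₂²w̄₃²` (self-crossed), `F_-`. [cite: ChesterEtAl2020, App. «Crossing vectors» (row 4)] -/
theorem derived_row3 (h : O2CrossingAt D G u v) (h' : O2CrossingAt D G v u) :
    Fm D.Δt (G .tttt0p - G .tttt0m) u v = 0 := by
  have e := (pair_of_crossing h h' .tttt adm_cA).1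
  simp only [cross, Dims.expo, cA_swap, S_tttt_cA] at e
  simp only [Fm, Pi.sub_apply] at e ⊢
  linear_combination e / 2

/-- Row 5: `⟨tttt⟩`, monomial `w₀²w₁²w̄₂²w̄₃² ↔ w̄₀²w₁²w₂²w̄₃²`, `F_-`, minus row 4. [cite: ChesterEtAl2020, App. «Crossing vectors» (row 5)] -/
theorem derived_row4 (h : O2CrossingAt D G u v) (h' : O2CrossingAt D G v u) :
    Fm D.Δt (G .tttt4) u v + 2 * Fm D.Δt (G .tttt0m) u v = 0 := by
  have e := (pair_of_crossing h h' .tttt adm_cB).1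
  have e0 := derived_row3 h h'
  simp only [cross, Dims.expo, S_tttt_cB, S_tttt_cBs] at e
  simp only [Fm, Pi.add_apply, Pi.sub_apply] at e e0 ⊢
  linear_combination e - e0

/-- Row 6: `⟨tttt⟩`, monomial `w₀²w₁²w̄₂²w̄₃² ↔ w̄₀²w₁²w₂²w̄₃²`, `F_+`. [cite: ChesterEtAl2020, App. «Crossing vectors» (row 6)] -/
theorem derived_row5 (h : O2CrossingAt D G u v) (h' : O2CrossingAt D G v u) :
    Fp D.Δt (G .tttt4) u v - Fp D.Δt (G .tttt0p + G .tttt0m) u v = 0 := by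
  have e := (pair_of_crossing h h' .tttt adm_cB).2
  simp only [cross, Dims.expo, S_tttt_cB, S_tttt_cBs] at e
  simp only [Fp, Pi.add_apply] at e ⊢
  linear_combination e

/-- Row 7: `⟨tφtφ⟩`, monomial `w₀²w̄₁w̄₂²w₃ ↔ w̄₀²w̄₁w₂²w₃`, `F_-`. [cite: ChesterEtAl2020, App. «Crossing vectors» (row 7)] -/
theorem derived_row6 (h : O2CrossingAt D G u v) (h' : O2CrossingAt D G v u) :
    Fm ((D.Δφ + D.Δt) / 2) (G .tφtφ1 + G .tφtφ3) u v = 0 := by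
  have e := (pair_of_crossing h h' .tφtφ adm_cC).1
  simp only [cross, Dims.expo, S_tφtφ_cC, S_tφtφ_cCs] at e
  simp only [Fm, Pi.add_apply] at e ⊢
  linear_combination e

/-- Row 8: `⟨tφtφ⟩`, same monomial pair, `F_+`. [cite: ChesterEtAl2020, App. «Crossing vectors» (row 8)] -/
theorem derived_row7 (h : O2CrossingAt D G u v) (h' : O2CrossingAt D G v u) :
    Fp ((D.Δφ + D.Δt) / 2) (G .tφtφ1) u v - Fp ((D.Δφ + D.Δt) / 2) (G .tφtφ3) u v = 0 := by
  have e := (pair_of_crossing h h' .tφtφ adm_cC).2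
  simp only [cross, Dims.expo, S_tφtφ_cC, S_tφtφ_cCs] at e
  simp only [Fp] at e ⊢
  linear_combination e

/-- Row 9: `⟨ttφφ⟩ ↔ ⟨φttφ⟩`, monomial `w₀²w̄₁²w̄₂w₃`, `F_-`. [cite: ChesterEtAl2020, App. «Crossing vectors» (row 9)] -/
theorem derived_row8 (h : O2CrossingAt D G u v) (h' : O2CrossingAt D G v u) :
    Fm ((D.Δφ + D.Δt) / 2) (G .ttφφ0p + G .ttφφ0m) u v + Fm D.Δt (G .φttφ3) u v = 0 := by
  have e := (pair_of_crossing h h' .ttφφ adm_cC).1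
  simp only [cross, Dims.expo, S_ttφφ_cC, S_φttφ_cCs] at e
  simp only [Fm, Pi.add_apply] at e ⊢
  linear_combination e

/-- Row 10: `⟨ttφφ⟩ ↔ ⟨φttφ⟩`, monomial `w₀²w̄₁²w₂w̄₃`, `F_-`. [cite: ChesterEtAl2020, App. «Crossing vectors» (row 10)] -/
theorem derived_row9 (h : O2CrossingAt D G u v) (h' : O2CrossingAt D G v u) :
    Fm ((D.Δφ + D.Δt) / 2) (G .ttφφ0p - G .ttφφ0m) u v + Fm D.Δt (G .φttφ1) u v = 0 := by
  have e := (pair_of_crossing h h' .ttφφ adm_cA).1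
  simp only [cross, Dims.expo, cA_swap, S_ttφφ_cA, S_φttφ_cA] at e
  simp only [Fm, Pi.sub_apply] at e ⊢
  linear_combination e

/-- Row 11: `⟨ttφφ⟩ ↔ ⟨φttφ⟩`, monomial `w₀²w̄₁²w̄₂w₃`, `F_+` (oriented from `⟨φttφ⟩`). [cite: ChesterEtAl2020, App. «Crossing vectors» (row 11)] -/
theorem derived_row10 (h : O2CrossingAt D G u v) (h' : O2CrossingAt D G v u) :
    Fp D.Δt (G .φttφ3) u v - Fp ((D.Δφ + D.Δt) / 2) (G .ttφφ0p + G .ttφφ0m) u v = 0 := by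
  have e := (pair_of_crossing h h' .ttφφ adm_cC).2
  simp only [cross, Dims.expo, S_ttφφ_cC, S_φttφ_cCs] at e
  simp only [Fp, Pi.add_apply] at e ⊢
  linear_combination -e

/-- Row 12: `⟨ttφφ⟩ ↔ ⟨φttφ⟩`, monomial `w₀²w̄₁²w₂w̄₃`, `F_+` (oriented from `⟨φttφ⟩`). [cite: ChesterEtAl2020, App. «Crossing vectors» (row 12)] -/
theorem derived_row11 (h : O2CrossingAt D G u v) (h' : O2CrossingAt D G v u) :
    Fp D.Δt (G .φttφ1) u v - Fp ((D.Δφ + D.Δt) / 2) (G .ttφφ0p - G .ttφφ0m) u v = 0 := by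
  have e := (pair_of_crossing h h' .ttφφ adm_cA).2
  simp only [cross, Dims.expo, cA_swap, S_ttφφ_cA, S_φttφ_cA] at e
  simp only [Fp, Pi.sub_apply] at e ⊢
  linear_combination -e

/-- Row 13: `⟨ssss⟩` (self-crossed), `F_-`. [cite: ChesterEtAl2020, App. «Crossing vectors» (row 13)] -/
theorem derived_row12 (h : O2CrossingAt D G u v) (h' : O2CrossingAt D G v u) :
    Fm D.Δs (G .ssss0p) u v = 0 := by
  have e := (pair_of_crossing h h' .ssss adm_cA).1
  simp only [cross, Dims.expo, S_ssss] at e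
  simp only [Fm] at e ⊢
  linear_combination e / 2

/-- Row 14: `⟨φsφs⟩`, monomial `w₀w̄₂` (self-crossed), `F_-`. [cite: ChesterEtAl2020, App. «Crossing vectors» (row 14)] -/
theorem derived_row13 (h : O2CrossingAt D G u v) (h' : O2CrossingAt D G v u) :
    Fm ((D.Δφ + D.Δs) / 2) (G .φsφs1) u v = 0 := by
  have e := (pair_of_crossing h h' .φsφs adm_cE).1
  simp only [cross, Dims.expo, S_φsφs_cE, S_φsφs_cEs] at e
  simp only [Fm] at e ⊢
  linear_combination e / 2

/-- Row 15: `⟨tsts⟩`, monomial `w₀²w̄₂²` (self-crossed), `F_-`. [cite: ChesterEtAl2020, App. «Crossing vectors» (row 15)] -/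
theorem derived_row14 (h : O2CrossingAt D G u v) (h' : O2CrossingAt D G v u) :
    Fm ((D.Δs + D.Δt) / 2) (G .tsts2) u v = 0 := by
  have e := (pair_of_crossing h h' .tsts adm_cE).1
  simp only [cross, Dims.expo, S_tsts_cE, S_tsts_cEs] at e
  simp only [Fm] at e ⊢
  linear_combination e / 2

/-- Row 16: `⟨ttss⟩ ↔ ⟨stts⟩`, monomial `w₀²w̄₁²`, `F_-`. [cite: ChesterEtAl2020, App. «Crossing vectors» (row 16)] -/
theorem derived_row15 (h : O2CrossingAt D G u v) (h' : O2CrossingAt D G v u) :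
    Fm ((D.Δs + D.Δt) / 2) (G .ttss0p) u v + Fm D.Δt (G .stts2) u v = 0 := by
  have e := (pair_of_crossing h h' .ttss adm_cF).1
  simp only [cross, Dims.expo, S_ttss_cF, S_stts_cFs] at e
  simp only [Fm] at e ⊢
  linear_combination e

/-- Row 17: `⟨ttss⟩ ↔ ⟨stts⟩`, monomial `w₀²w̄₁²`, `F_+`. [cite: ChesterEtAl2020, App. «Crossing vectors» (row 17)] -/
theorem derived_row16 (h : O2CrossingAt D G u v) (h' : O2CrossingAt D G v u) :
    Fp ((D.Δs + D.Δt) / 2) (G .ttss0p) u v - Fp D.Δt (G .stts2) u v = 0 := by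
  have e := (pair_of_crossing h h' .ttss adm_cF).2
  simp only [cross, Dims.expo, S_ttss_cF, S_stts_cFs] at e
  simp only [Fp] at e ⊢
  linear_combination e

/-- Row 18: `⟨φφss⟩ ↔ ⟨sφφs⟩`, monomial `w₀w̄₁`, `F_-`. [cite: ChesterEtAl2020, App. «Crossing vectors» (row 18)] -/
theorem derived_row17 (h : O2CrossingAt D G u v) (h' : O2CrossingAt D G v u) :
    Fm ((D.Δφ + D.Δs) / 2) (G .φφss0p) u v + Fm D.Δφ (G .sφφs1) u v = 0 := by
  have e := (pair_of_crossing h h' .φφss adm_cF).1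
  simp only [cross, Dims.expo, S_φφss_cF, S_sφφs_cFs] at e
  simp only [Fm] at e ⊢
  linear_combination e

/-- Row 19: `⟨φφss⟩ ↔ ⟨sφφs⟩`, monomial `w₀w̄₁`, `F_+`. [cite: ChesterEtAl2020, App. «Crossing vectors» (row 19)] -/
theorem derived_row18 (h : O2CrossingAt D G u v) (h' : O2CrossingAt D G v u) :
    Fp ((D.Δφ + D.Δs) / 2) (G .φφss0p) u v - Fp D.Δφ (G .sφφs1) u v = 0 := by
  have e := (pair_of_crossing h h' .φφss adm_cF).2
  simp only [cross, Dims.expo, S_φφss_cF, S_sφφs_cFs] at e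
  simp only [Fp] at e ⊢
  linear_combination e

/-- Row 20: `⟨φsφt⟩`, monomial `w₀w₂w̄₃²` (self-crossed), `F_-`. [cite: ChesterEtAl2020, App. «Crossing vectors» (row 20)] -/
theorem derived_row19 (h : O2CrossingAt D G u v) (h' : O2CrossingAt D G v u) :
    Fm ((D.Δφ + D.Δs) / 2) (G .φsφt1) u v = 0 := by
  have e := (pair_of_crossing h h' .φsφt adm_cG).1
  simp only [cross, Dims.expo, cG_swap, S_φsφt_cG] at e
  simp only [Fm] at e ⊢
  linear_combination e / 2

/-- Row 21: `⟨φφst⟩ ↔ ⟨sφφt⟩`, monomial `w̄₀w̄₁w₃²`, `F_-`. [cite: ChesterEtAl2020, App. «Crossing vectors» (row 21)] -/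
theorem derived_row20 (h : O2CrossingAt D G u v) (h' : O2CrossingAt D G v u) :
    Fm ((D.Δφ + D.Δs) / 2) (G .φφst2) u v + Fm D.Δφ (G .sφφt1) u v = 0 := by
  have e := (pair_of_crossing h h' .φφst adm_cH).1
  simp only [cross, Dims.expo, S_φφst_cH, S_sφφt_cHs] at e
  simp only [Fm] at e ⊢
  linear_combination e

/-- Row 22: `⟨φφst⟩ ↔ ⟨sφφt⟩`, monomial `w̄₀w̄₁w₃²`, `F_+` (oriented from `⟨sφφt⟩`). [cite: ChesterEtAl2020, App. «Crossing vectors» (row 22)] -/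
theorem derived_row21 (h : O2CrossingAt D G u v) (h' : O2CrossingAt D G v u) :
    Fp D.Δφ (G .sφφt1) u v - Fp ((D.Δφ + D.Δs) / 2) (G .φφst2) u v = 0 := by
  have e := (pair_of_crossing h h' .φφst adm_cH).2
  simp only [cross, Dims.expo, S_φφst_cH, S_sφφt_cHs] at e
  simp only [Fp] at e ⊢
  linear_combination -e

/-- **Crossing symmetry implies the 22 derived equations.** [cite: ChesterEtAl2020, §2.1 (crossing equations)] -/
theorem derivedVec_eq_zero (h : O2CrossingAt D G u v) (h' : O2CrossingAt D G v u) :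
    derivedVec D G u v = 0 := by
  funext r
  fin_cases r <;> simp only [derivedVec, Matrix.cons_val_zero', Matrix.cons_val_succ', Pi.zero_apply]
  exacts [derived_row0 h h', derived_row1 h h', derived_row2 h h', derived_row3 h h', derived_row4 h h',
    derived_row5 h h', derived_row6 h h', derived_row7 h h', derived_row8 h h', derived_row9 h h',
    derived_row10 h h', derived_row11 h h', derived_row12 h h', derived_row13 h h', derived_row14 h h',
    derived_row15 h h', derived_row16 h h', derived_row17 h h', derived_row18 h h', derived_row19 h h',
    derived_row20 h h', derived_row21 h h']

end Forward

/-! ## 6. The 22 derived equations ⟹ crossing symmetry (admissible normal forms) -/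

section Backward
variable (c : Flav)

/-- Coefficient of `𝒢_{0⁺} − 𝒢_{0⁻}` in `S_{φφφφ}`: `w₀w̄₁w₂w̄₃ + w̄₀w₁w̄₂w₃`. [folklore] -/
private def mA : ℝ := c.w0 * c.b1 * c.w2 * c.b3 + c.b0 * c.w1 * c.b2 * c.w3
/-- Coefficient of `𝒢_{0⁺} + 𝒢_{0⁻}` in `S_{φφφφ}`: `w₀w̄₁w̄₂w₃ + w̄₀w₁w₂w̄₃`. [folklore] -/
private def mB : ℝ := c.w0 * c.b1 * c.b2 * c.w3 + c.b0 * c.w1 * c.w2 * c.b3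
/-- Coefficient of `𝒢_{2}` in `S_{φφφφ}`: `w₀w₁w̄₂w̄₃ + w̄₀w̄₁w₂w₃`. [folklore] -/
private def m2 : ℝ := c.w0 * c.w1 * c.b2 * c.b3 + c.b0 * c.b1 * c.w2 * c.w3
/-- `⟨tttt⟩` analogue of `mA` (squares). [folklore] -/
private def MA : ℝ := c.w0 ^ 2 * c.b1 ^ 2 * c.w2 ^ 2 * c.b3 ^ 2 + c.b0 ^ 2 * c.w1 ^ 2 * c.b2 ^ 2 * c.w3 ^ 2
/-- `⟨tttt⟩` analogue of `mB`. [folklore] -/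
private def MB : ℝ := c.w0 ^ 2 * c.b1 ^ 2 * c.b2 ^ 2 * c.w3 ^ 2 + c.b0 ^ 2 * c.w1 ^ 2 * c.w2 ^ 2 * c.b3 ^ 2
/-- `⟨tttt⟩` analogue of `m2` (irrep `4`). [folklore] -/
private def M4 : ℝ := c.w0 ^ 2 * c.w1 ^ 2 * c.b2 ^ 2 * c.b3 ^ 2 + c.b0 ^ 2 * c.b1 ^ 2 * c.w2 ^ 2 * c.w3 ^ 2
/-- Coefficient of `𝒢^{tφtφ}_1` on admissible configurations: `w₀²w̄₁w̄₂²w₃ + w̄₀²w₁w₂²w̄₃`. [folklore] -/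
private def N1 : ℝ := c.w0 ^ 2 * c.b1 * c.b2 ^ 2 * c.w3 + c.b0 ^ 2 * c.w1 * c.w2 ^ 2 * c.b3
/-- Coefficient of `𝒢^{tφtφ}_3` (`= T^3` exactly): `w₀²w₁w̄₂²w̄₃ + w̄₀²w̄₁w₂²w₃`. [folklore] -/
private def N3 : ℝ := c.w0 ^ 2 * c.w1 * c.b2 ^ 2 * c.b3 + c.b0 ^ 2 * c.b1 * c.w2 ^ 2 * c.w3
/-- Coefficient of `𝒢^{φttφ}_1` on admissible configurations. [folklore] -/
private def J1 : ℝ := c.w1 ^ 2 * c.b0 * c.b2 ^ 2 * c.w3 + c.b1 ^ 2 * c.w0 * c.w2 ^ 2 * c.b3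
/-- Coefficient of `𝒢^{φttφ}_3` (`= T^3` exactly). [folklore] -/
private def J3 : ℝ := c.w1 ^ 2 * c.w0 * c.b2 ^ 2 * c.b3 + c.b1 ^ 2 * c.b0 * c.w2 ^ 2 * c.w3
/-- Coefficient of `𝒢^{ttφφ}_{0⁺} − 𝒢^{ttφφ}_{0⁻}` on admissible configurations: `w₀²w̄₁²w₂w̄₃ + w̄₀²w₁²w̄₂w₃`. [folklore] -/
private def KA : ℝ := c.w0 ^ 2 * c.b1 ^ 2 * c.w2 * c.b3 + c.b0 ^ 2 * c.w1 ^ 2 * c.b2 * c.w3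
/-- Coefficient of `𝒢^{ttφφ}_{0⁺} + 𝒢^{ttφφ}_{0⁻}` on admissible configurations: `w₀²w̄₁²w̄₂w₃ + w̄₀²w₁²w₂w̄₃`. [folklore] -/
private def KB : ℝ := c.w0 ^ 2 * c.b1 ^ 2 * c.b2 * c.w3 + c.b0 ^ 2 * c.w1 ^ 2 * c.w2 * c.b3
/-- Coefficient of `𝒢^{ttss}` on admissible configurations: `w₀²w̄₁² + w̄₀²w₁²`. [folklore] -/
private def R01 : ℝ := c.w0 ^ 2 * c.b1 ^ 2 + c.b0 ^ 2 * c.w1 ^ 2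
/-- Coefficient of `𝒢^{φsφt}` on admissible configurations: `w₀w₂w̄₃² + w̄₀w̄₂w₃²`. [folklore] -/
private def Q02 : ℝ := c.w0 * c.w2 * c.b3 ^ 2 + c.b0 * c.b2 * c.w3 ^ 2
/-- Coefficient of `𝒢^{sφφt}` on admissible configurations: `w₁w₂w̄₃² + w̄₁w̄₂w₃²`. [folklore] -/
private def U12 : ℝ := c.w1 * c.w2 * c.b3 ^ 2 + c.b1 * c.b2 * c.w3 ^ 2

/-- Behaviour of a coefficient polynomial under the position exchange `0 ↔ 2` (plumbing for §6). [folklore] -/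
private theorem mA_swap : mA c.swap = mA c := by simp only [mA, Flav.swap]; ring
/-- Behaviour of a coefficient polynomial under the position exchange `0 ↔ 2` (plumbing for §6). [folklore] -/
private theorem mB_swap : mB c.swap = m2 c := by simp only [mB, m2, Flav.swap]; ring
/-- Behaviour of a coefficient polynomial under the position exchange `0 ↔ 2` (plumbing for §6). [folklore] -/
private theorem m2_swap : m2 c.swap = mB c := by simp only [mB, m2, Flav.swap]; ring
/-- Behaviour of a coefficient polynomial under the position exchange `0 ↔ 2` (plumbing for §6). [folklore] -/
private theorem MA_swap : MA c.swap = MA c := by simp only [MA, Flav.swap]; ring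
/-- Behaviour of a coefficient polynomial under the position exchange `0 ↔ 2` (plumbing for §6). [folklore] -/
private theorem MB_swap : MB c.swap = M4 c := by simp only [MB, M4, Flav.swap]; ring
/-- Behaviour of a coefficient polynomial under the position exchange `0 ↔ 2` (plumbing for §6). [folklore] -/
private theorem M4_swap : M4 c.swap = MB c := by simp only [MB, M4, Flav.swap]; ring
/-- Behaviour of a coefficient polynomial under the position exchange `0 ↔ 2` (plumbing for §6). [folklore] -/
private theorem N1_swap : N1 c.swap = N3 c := by simp only [N1, N3, Flav.swap]; ring
/-- Behaviour of a coefficient polynomial under the position exchange `0 ↔ 2` (plumbing for §6). [folklore] -/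
private theorem N3_swap : N3 c.swap = N1 c := by simp only [N1, N3, Flav.swap]; ring
/-- Behaviour of a coefficient polynomial under the position exchange `0 ↔ 2` (plumbing for §6). [folklore] -/
private theorem J1_swap : J1 c.swap = KA c := by simp only [J1, KA, Flav.swap]; ring
/-- Behaviour of a coefficient polynomial under the position exchange `0 ↔ 2` (plumbing for §6). [folklore] -/
private theorem J3_swap : J3 c.swap = KB c := by simp only [J3, KB, Flav.swap]; ring
/-- Behaviour of a coefficient polynomial under the position exchange `0 ↔ 2` (plumbing for §6). [folklore] -/
private theorem KA_swap : KA c.swap = J1 c := by simp only [J1, KA, Flav.swap]; ring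
/-- Behaviour of a coefficient polynomial under the position exchange `0 ↔ 2` (plumbing for §6). [folklore] -/
private theorem KB_swap : KB c.swap = J3 c := by simp only [J3, KB, Flav.swap]; ring
/-- Behaviour of a coefficient polynomial under the position exchange `0 ↔ 2` (plumbing for §6). [folklore] -/
private theorem Tstts2_swap : Tstts2 c.swap = R01 c := by simp only [Tstts2, R01, Flav.swap]; ring
/-- Behaviour of a coefficient polynomial under the position exchange `0 ↔ 2` (plumbing for §6). [folklore] -/
private theorem R01_swap : R01 c.swap = Tstts2 c := by simp only [Tstts2, R01, Flav.swap]; ring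
/-- Behaviour of a coefficient polynomial under the position exchange `0 ↔ 2` (plumbing for §6). [folklore] -/
private theorem Tφsφs1_swap : Tφsφs1 c.swap = Tφsφs1 c := by simp only [Tφsφs1, Flav.swap]; ring
/-- Behaviour of a coefficient polynomial under the position exchange `0 ↔ 2` (plumbing for §6). [folklore] -/
private theorem Ttsts2_swap : Ttsts2 c.swap = Ttsts2 c := by simp only [Ttsts2, Flav.swap]; ring
/-- Behaviour of a coefficient polynomial under the position exchange `0 ↔ 2` (plumbing for §6). [folklore] -/
private theorem Tsφφs1_swap : Tsφφs1 c.swap = Tφφss0p c := by simp only [Tsφφs1, Tφφss0p, Flav.swap]; ring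
/-- Behaviour of a coefficient polynomial under the position exchange `0 ↔ 2` (plumbing for §6). [folklore] -/
private theorem Tφφss0p_swap : Tφφss0p c.swap = Tsφφs1 c := by simp only [Tsφφs1, Tφφss0p, Flav.swap]; ring
/-- Behaviour of a coefficient polynomial under the position exchange `0 ↔ 2` (plumbing for §6). [folklore] -/
private theorem Q02_swap : Q02 c.swap = Q02 c := by simp only [Q02, Flav.swap]; ring
/-- Behaviour of a coefficient polynomial under the position exchange `0 ↔ 2` (plumbing for §6). [folklore] -/
private theorem U12_swap : U12 c.swap = Tφφst2 c := by simp only [U12, Tφφst2, Flav.swap]; ring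
/-- Behaviour of a coefficient polynomial under the position exchange `0 ↔ 2` (plumbing for §6). [folklore] -/
private theorem Tφφst2_swap : Tφφst2 c.swap = U12 c := by simp only [U12, Tφφst2, Flav.swap]; ring

variable (G : Sec → ℝ → ℝ → ℝ)

/-- Normal form of `S_{φφφφ}` (an identity, no admissibility needed). [folklore] -/
private theorem nf_φφφφ (x y : ℝ) : S G .φφφφ c x y =
    mA c * (G .φφφφ0p x y - G .φφφφ0m x y) + mB c * (G .φφφφ0p x y + G .φφφφ0m x y) +
      m2 c * G .φφφφ2 x y := by
  simp only [S, Tφφφφ0p, Tφφφφ0m, Tφφφφ2, mA, mB, m2]; ring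

/-- `S_{stts} = T^2 · 𝒢^{stts}_2` (by definition). [folklore] -/
private theorem S_stts (x y : ℝ) : S G .stts c x y = Tstts2 c * G .stts2 x y := rfl

/-- `S_{φφst} = T^2 · 𝒢^{φφst}_2` (by definition). [folklore] -/
private theorem S_φφst (x y : ℝ) : S G .φφst c x y = Tφφst2 c * G .φφst2 x y := rfl

variable {c}

/-- Normal form of `S_{tttt}` on admissible configurations (`w_iw̄_i = 0`). [folklore] -/
private theorem nf_tttt (hc : c.Adm) (x y : ℝ) : S G .tttt c x y =
    MA c * (G .tttt0p x y - G .tttt0m x y) + MB c * (G .tttt0p x y + G .tttt0m x y) +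
      M4 c * G .tttt4 x y := by
  obtain ⟨h0, h1, h2, h3⟩ := hc
  rcases mul_eq_zero.1 h0 with h0 | h0 <;> rcases mul_eq_zero.1 h1 with h1 | h1 <;>
    rcases mul_eq_zero.1 h2 with h2 | h2 <;> rcases mul_eq_zero.1 h3 with h3 | h3 <;>
    simp only [S, Ttttt0p, Ttttt0m, Ttttt4, MA, MB, M4, h0, h1, h2, h3] <;> ring

/-- Normal form of `S_{tφtφ}` on admissible configurations. [folklore] -/
private theorem nf_tφtφ (hc : c.Adm) (x y : ℝ) : S G .tφtφ c x y = N1 c * G .tφtφ1 x y + N3 c * G .tφtφ3 x y := by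
  obtain ⟨h0, h1, h2, h3⟩ := hc
  rcases mul_eq_zero.1 h0 with h0 | h0 <;> rcases mul_eq_zero.1 h1 with h1 | h1 <;>
    rcases mul_eq_zero.1 h2 with h2 | h2 <;> rcases mul_eq_zero.1 h3 with h3 | h3 <;>
    simp only [S, Ttφtφ1, Ttφtφ3, N1, N3, h0, h1, h2, h3] <;> ring

/-- Normal form of `S_{φttφ}` on admissible configurations. [folklore] -/
private theorem nf_φttφ (hc : c.Adm) (x y : ℝ) : S G .φttφ c x y = J1 c * G .φttφ1 x y + J3 c * G .φttφ3 x y := by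
  obtain ⟨h0, h1, h2, h3⟩ := hc
  rcases mul_eq_zero.1 h0 with h0 | h0 <;> rcases mul_eq_zero.1 h1 with h1 | h1 <;>
    rcases mul_eq_zero.1 h2 with h2 | h2 <;> rcases mul_eq_zero.1 h3 with h3 | h3 <;>
    simp only [S, Tφttφ1, Tφttφ3, J1, J3, h0, h1, h2, h3] <;> ring

/-- Normal form of `S_{ttφφ}` on admissible configurations. [folklore] -/
private theorem nf_ttφφ (hc : c.Adm) (x y : ℝ) : S G .ttφφ c x y =
    KA c * (G .ttφφ0p x y - G .ttφφ0m x y) + KB c * (G .ttφφ0p x y + G .ttφφ0m x y) := by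
  obtain ⟨h0, h1, h2, h3⟩ := hc
  rcases mul_eq_zero.1 h0 with h0 | h0 <;> rcases mul_eq_zero.1 h1 with h1 | h1 <;>
    rcases mul_eq_zero.1 h2 with h2 | h2 <;> rcases mul_eq_zero.1 h3 with h3 | h3 <;>
    simp only [S, Tttφφ0p, Tttφφ0m, KA, KB, h0, h1, h2, h3] <;> ring

/-- Normal form of `S_{ttss}` on admissible configurations. [folklore] -/
private theorem nf_ttss (hc : c.Adm) (x y : ℝ) : S G .ttss c x y = R01 c * G .ttss0p x y := by
  obtain ⟨h0, h1, h2, h3⟩ := hc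
  rcases mul_eq_zero.1 h0 with h0 | h0 <;> rcases mul_eq_zero.1 h1 with h1 | h1 <;>
    simp only [S, Tttss0p, R01, h0, h1] <;> ring

/-- Normal form of `S_{φsφt}` on admissible configurations. [folklore] -/
private theorem nf_φsφt (hc : c.Adm) (x y : ℝ) : S G .φsφt c x y = Q02 c * G .φsφt1 x y := by
  obtain ⟨h0, h1, h2, h3⟩ := hc
  rcases mul_eq_zero.1 h3 with h3 | h3 <;> simp only [S, Tφsφt1, Q02, h3] <;> ring

/-- Normal form of `S_{sφφt}` on admissible configurations. [folklore] -/
private theorem nf_sφφt (hc : c.Adm) (x y : ℝ) : S G .sφφt c x y = U12 c * G .sφφt1 x y := by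
  obtain ⟨h0, h1, h2, h3⟩ := hc
  rcases mul_eq_zero.1 h3 with h3 | h3 <;> simp only [S, Tsφφt1, U12, h3] <;> ring

variable {G} {D : Dims} {u v : ℝ}

/-- `⟨φφφφ⟩` crossing from rows 1–3. 
[cite: ChesterEtAl2020, §2.1 (Table 1; eq. (4point))] [cite: KosPolandSimmonsDuffinVichi2015, §2 (crossing equation)] -/
theorem crossing_φφφφ (r0 : Fm D.Δφ (G .φφφφ0p - G .φφφφ0m) u v = 0)
    (r1 : Fm D.Δφ (G .φφφφ2) u v + 2 * Fm D.Δφ (G .φφφφ0m) u v = 0)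
    (r2 : Fp D.Δφ (G .φφφφ2) u v - Fp D.Δφ (G .φφφφ0p + G .φφφφ0m) u v = 0) :
    CrossingAt D G .φφφφ u v := by
  intro c _
  simp only [MixedCrossingAt, cross, Dims.expo, nf_φφφφ, mA_swap, mB_swap, m2_swap]
  simp only [Fm, Fp, Pi.add_apply, Pi.sub_apply] at r0 r1 r2
  linear_combination (mA c) * r0 + (mB c) * (r0 + r1 - r2) / 2 + (m2 c) * (r0 + r1 + r2) / 2

/-- `⟨tttt⟩` crossing from rows 4–6. 
[cite: ChesterEtAl2020, §2.1 (Table 1; eq. (4point))] [cite: KosPolandSimmonsDuffinVichi2015, §2 (crossing equation)] -/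
theorem crossing_tttt (r3 : Fm D.Δt (G .tttt0p - G .tttt0m) u v = 0)
    (r4 : Fm D.Δt (G .tttt4) u v + 2 * Fm D.Δt (G .tttt0m) u v = 0)
    (r5 : Fp D.Δt (G .tttt4) u v - Fp D.Δt (G .tttt0p + G .tttt0m) u v = 0) :
    CrossingAt D G .tttt u v := by
  intro c hc
  simp only [MixedCrossingAt, cross, Dims.expo, nf_tttt G hc, nf_tttt G hc.swap, MA_swap, MB_swap, M4_swap]
  simp only [Fm, Fp, Pi.add_apply, Pi.sub_apply] at r3 r4 r5
  linear_combination (MA c) * r3 + (MB c) * (r3 + r4 - r5) / 2 + (M4 c) * (r3 + r4 + r5) / 2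

/-- `⟨tφtφ⟩` crossing from rows 7–8. 
[cite: ChesterEtAl2020, §2.1 (Table 1; eq. (4point))] [cite: KosPolandSimmonsDuffinVichi2015, §2 (crossing equation)] -/
theorem crossing_tφtφ (r6 : Fm ((D.Δφ + D.Δt) / 2) (G .tφtφ1 + G .tφtφ3) u v = 0)
    (r7 : Fp ((D.Δφ + D.Δt) / 2) (G .tφtφ1) u v - Fp ((D.Δφ + D.Δt) / 2) (G .tφtφ3) u v = 0) :
    CrossingAt D G .tφtφ u v := by
  intro c hc
  simp only [MixedCrossingAt, cross, Dims.expo, nf_tφtφ G hc, nf_tφtφ G hc.swap, N1_swap, N3_swap]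
  simp only [Fm, Fp, Pi.add_apply] at r6 r7
  linear_combination (N1 c) * (r6 + r7) / 2 + (N3 c) * (r6 - r7) / 2

/-- `⟨ttφφ⟩` crossing (into `⟨φttφ⟩`) from rows 9–12. 
[cite: ChesterEtAl2020, §2.1 (Table 1; eq. (4point))] [cite: KosPolandSimmonsDuffinVichi2015, §2 (crossing equation)] -/
theorem crossing_ttφφ (r8 : Fm ((D.Δφ + D.Δt) / 2) (G .ttφφ0p + G .ttφφ0m) u v + Fm D.Δt (G .φttφ3) u v = 0)
    (r9 : Fm ((D.Δφ + D.Δt) / 2) (G .ttφφ0p - G .ttφφ0m) u v + Fm D.Δt (G .φttφ1) u v = 0)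
    (r10 : Fp D.Δt (G .φttφ3) u v - Fp ((D.Δφ + D.Δt) / 2) (G .ttφφ0p + G .ttφφ0m) u v = 0)
    (r11 : Fp D.Δt (G .φttφ1) u v - Fp ((D.Δφ + D.Δt) / 2) (G .ttφφ0p - G .ttφφ0m) u v = 0) :
    CrossingAt D G .ttφφ u v := by
  intro c hc
  simp only [MixedCrossingAt, cross, Dims.expo, nf_ttφφ G hc, nf_φttφ G hc.swap, J1_swap, J3_swap]
  simp only [Fm, Fp, Pi.add_apply, Pi.sub_apply] at r8 r9 r10 r11
  linear_combination (KA c) * (r9 - r11) / 2 + (KB c) * (r8 - r10) / 2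

/-- `⟨φttφ⟩` crossing (into `⟨ttφφ⟩`) from rows 9–12. 
[cite: ChesterEtAl2020, §2.1 (Table 1; eq. (4point))] [cite: KosPolandSimmonsDuffinVichi2015, §2 (crossing equation)] -/
theorem crossing_φttφ (r8 : Fm ((D.Δφ + D.Δt) / 2) (G .ttφφ0p + G .ttφφ0m) u v + Fm D.Δt (G .φttφ3) u v = 0)
    (r9 : Fm ((D.Δφ + D.Δt) / 2) (G .ttφφ0p - G .ttφφ0m) u v + Fm D.Δt (G .φttφ1) u v = 0)
    (r10 : Fp D.Δt (G .φttφ3) u v - Fp ((D.Δφ + D.Δt) / 2) (G .ttφφ0p + G .ttφφ0m) u v = 0)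
    (r11 : Fp D.Δt (G .φttφ1) u v - Fp ((D.Δφ + D.Δt) / 2) (G .ttφφ0p - G .ttφφ0m) u v = 0) :
    CrossingAt D G .φttφ u v := by
  intro c hc
  simp only [MixedCrossingAt, cross, Dims.expo, nf_φttφ G hc, nf_ttφφ G hc.swap, KA_swap, KB_swap]
  simp only [Fm, Fp, Pi.add_apply, Pi.sub_apply] at r8 r9 r10 r11
  linear_combination (J1 c) * (r9 + r11) / 2 + (J3 c) * (r8 + r10) / 2

/-- `⟨ssss⟩` crossing from row 13. 
[cite: ChesterEtAl2020, §2.1 (Table 1; eq. (4point))] [cite: KosPolandSimmonsDuffinVichi2015, §2 (crossing equation)] -/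
theorem crossing_ssss (r12 : Fm D.Δs (G .ssss0p) u v = 0) : CrossingAt D G .ssss u v := by
  intro c _
  simp only [MixedCrossingAt, cross, Dims.expo, S]
  simp only [Fm] at r12
  linear_combination r12

/-- `⟨φsφs⟩` crossing from row 14. 
[cite: ChesterEtAl2020, §2.1 (Table 1; eq. (4point))] [cite: KosPolandSimmonsDuffinVichi2015, §2 (crossing equation)] -/
theorem crossing_φsφs (r13 : Fm ((D.Δφ + D.Δs) / 2) (G .φsφs1) u v = 0) : CrossingAt D G .φsφs u v := by
  intro c _
  simp only [MixedCrossingAt, cross, Dims.expo, S, Tφsφs1_swap]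
  simp only [Fm] at r13
  linear_combination (Tφsφs1 c) * r13

/-- `⟨tsts⟩` crossing from row 15. 
[cite: ChesterEtAl2020, §2.1 (Table 1; eq. (4point))] [cite: KosPolandSimmonsDuffinVichi2015, §2 (crossing equation)] -/
theorem crossing_tsts (r14 : Fm ((D.Δs + D.Δt) / 2) (G .tsts2) u v = 0) : CrossingAt D G .tsts u v := by
  intro c _
  simp only [MixedCrossingAt, cross, Dims.expo, S, Ttsts2_swap]
  simp only [Fm] at r14
  linear_combination (Ttsts2 c) * r14

/-- `⟨ttss⟩` crossing (into `⟨stts⟩`) from rows 16–17. 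
[cite: ChesterEtAl2020, §2.1 (Table 1; eq. (4point))] [cite: KosPolandSimmonsDuffinVichi2015, §2 (crossing equation)] -/
theorem crossing_ttss (r15 : Fm ((D.Δs + D.Δt) / 2) (G .ttss0p) u v + Fm D.Δt (G .stts2) u v = 0)
    (r16 : Fp ((D.Δs + D.Δt) / 2) (G .ttss0p) u v - Fp D.Δt (G .stts2) u v = 0) :
    CrossingAt D G .ttss u v := by
  intro c hc
  simp only [MixedCrossingAt, cross, Dims.expo, nf_ttss G hc, S_stts, Tstts2_swap]
  simp only [Fm, Fp] at r15 r16
  linear_combination (R01 c) * (r15 + r16) / 2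

/-- `⟨stts⟩` crossing (into `⟨ttss⟩`) from rows 16–17. 
[cite: ChesterEtAl2020, §2.1 (Table 1; eq. (4point))] [cite: KosPolandSimmonsDuffinVichi2015, §2 (crossing equation)] -/
theorem crossing_stts (r15 : Fm ((D.Δs + D.Δt) / 2) (G .ttss0p) u v + Fm D.Δt (G .stts2) u v = 0)
    (r16 : Fp ((D.Δs + D.Δt) / 2) (G .ttss0p) u v - Fp D.Δt (G .stts2) u v = 0) :
    CrossingAt D G .stts u v := by
  intro c hc
  simp only [MixedCrossingAt, cross, Dims.expo, S_stts, nf_ttss G hc.swap, R01_swap]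
  simp only [Fm, Fp] at r15 r16
  linear_combination (Tstts2 c) * (r15 - r16) / 2

/-- `⟨φφss⟩` crossing (into `⟨sφφs⟩`) from rows 18–19. 
[cite: ChesterEtAl2020, §2.1 (Table 1; eq. (4point))] [cite: KosPolandSimmonsDuffinVichi2015, §2 (crossing equation)] -/
theorem crossing_φφss (r17 : Fm ((D.Δφ + D.Δs) / 2) (G .φφss0p) u v + Fm D.Δφ (G .sφφs1) u v = 0)
    (r18 : Fp ((D.Δφ + D.Δs) / 2) (G .φφss0p) u v - Fp D.Δφ (G .sφφs1) u v = 0) :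
    CrossingAt D G .φφss u v := by
  intro c _
  simp only [MixedCrossingAt, cross, Dims.expo, S, Tsφφs1_swap]
  simp only [Fm, Fp] at r17 r18
  linear_combination (Tφφss0p c) * (r17 + r18) / 2

/-- `⟨sφφs⟩` crossing (into `⟨φφss⟩`) from rows 18–19. 
[cite: ChesterEtAl2020, §2.1 (Table 1; eq. (4point))] [cite: KosPolandSimmonsDuffinVichi2015, §2 (crossing equation)] -/
theorem crossing_sφφs (r17 : Fm ((D.Δφ + D.Δs) / 2) (G .φφss0p) u v + Fm D.Δφ (G .sφφs1) u v = 0)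
    (r18 : Fp ((D.Δφ + D.Δs) / 2) (G .φφss0p) u v - Fp D.Δφ (G .sφφs1) u v = 0) :
    CrossingAt D G .sφφs u v := by
  intro c _
  simp only [MixedCrossingAt, cross, Dims.expo, S, Tφφss0p_swap]
  simp only [Fm, Fp] at r17 r18
  linear_combination (Tsφφs1 c) * (r17 - r18) / 2

/-- `⟨φsφt⟩` crossing from row 20. 
[cite: ChesterEtAl2020, §2.1 (Table 1; eq. (4point))] [cite: KosPolandSimmonsDuffinVichi2015, §2 (crossing equation)] -/
theorem crossing_φsφt (r19 : Fm ((D.Δφ + D.Δs) / 2) (G .φsφt1) u v = 0) : CrossingAt D G .φsφt u v := by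
  intro c hc
  simp only [MixedCrossingAt, cross, Dims.expo, nf_φsφt G hc, nf_φsφt G hc.swap, Q02_swap]
  simp only [Fm] at r19
  linear_combination (Q02 c) * r19

/-- `⟨φφst⟩` crossing (into `⟨sφφt⟩`) from rows 21–22. 
[cite: ChesterEtAl2020, §2.1 (Table 1; eq. (4point))] [cite: KosPolandSimmonsDuffinVichi2015, §2 (crossing equation)] -/
theorem crossing_φφst (r20 : Fm ((D.Δφ + D.Δs) / 2) (G .φφst2) u v + Fm D.Δφ (G .sφφt1) u v = 0)
    (r21 : Fp D.Δφ (G .sφφt1) u v - Fp ((D.Δφ + D.Δs) / 2) (G .φφst2) u v = 0) :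
    CrossingAt D G .φφst u v := by
  intro c hc
  simp only [MixedCrossingAt, cross, Dims.expo, S_φφst, nf_sφφt G hc.swap, U12_swap]
  simp only [Fm, Fp] at r20 r21
  linear_combination (Tφφst2 c) * (r20 - r21) / 2

/-- `⟨sφφt⟩` crossing (into `⟨φφst⟩`) from rows 21–22. 
[cite: ChesterEtAl2020, §2.1 (Table 1; eq. (4point))] [cite: KosPolandSimmonsDuffinVichi2015, §2 (crossing equation)] -/
theorem crossing_sφφt (r20 : Fm ((D.Δφ + D.Δs) / 2) (G .φφst2) u v + Fm D.Δφ (G .sφφt1) u v = 0)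
    (r21 : Fp D.Δφ (G .sφφt1) u v - Fp ((D.Δφ + D.Δs) / 2) (G .φφst2) u v = 0) :
    CrossingAt D G .sφφt u v := by
  intro c hc
  simp only [MixedCrossingAt, cross, Dims.expo, nf_sφφt G hc, S_φφst, Tφφst2_swap]
  simp only [Fm, Fp] at r20 r21
  linear_combination (U12 c) * (r20 + r21) / 2

/-- **The 22 derived equations imply crossing symmetry of all fifteen orderings at `(u,v)`.**
[cite: ChesterEtAl2020, §2.1 (crossing equations)] -/
theorem o2CrossingAt_of_derivedVec (hV : derivedVec D G u v = 0) : O2CrossingAt D G u v := by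
  have r : ∀ k, derivedVec D G u v k = 0 := fun k => by rw [hV]; rfl
  have r0 := r 0; have r1 := r 1; have r2 := r 2; have r3 := r 3; have r4 := r 4; have r5 := r 5
  have r6 := r 6; have r7 := r 7; have r8 := r 8; have r9 := r 9; have r10 := r 10; have r11 := r 11
  have r12 := r 12; have r13 := r 13; have r14 := r 14; have r15 := r 15; have r16 := r 16
  have r17 := r 17; have r18 := r 18; have r19 := r 19; have r20 := r 20; have r21 := r 21
  simp only [derivedVec, Matrix.cons_val] at r0 r1 r2 r3 r4 r5 r6 r7 r8 r9 r10
  simp only [derivedVec, Matrix.cons_val] at r11 r12 r13 r14 r15 r16 r17 r18 r19 r20 r21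
  intro L
  cases L
  exacts [crossing_φφφφ r0 r1 r2, crossing_tttt r3 r4 r5, crossing_ssss r12, crossing_ttφφ r8 r9 r10 r11,
    crossing_ttss r15 r16, crossing_φφss r17 r18, crossing_tφtφ r6 r7, crossing_φttφ r8 r9 r10 r11,
    crossing_φsφs r13, crossing_sφφs r17 r18, crossing_φsφt r19, crossing_sφφt r20 r21, crossing_tsts r14,
    crossing_stts r15 r16, crossing_φφst r20 r21]

/-- Each derived row at `(v,u)` is `±` the same row at `(u,v)` (`F_∓` are odd/even under `u ↔ v`); hence the
rows at `(u,v)` also vanish at `(v,u)`. [cite: KosPolandSimmonsDuffinVichi2015, §2 (`F^{ij,kl}_∓`, (anti)symmetrisation in `u, v`)] -/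
theorem derivedVec_swap_eq_zero (hV : derivedVec D G u v = 0) : derivedVec D G v u = 0 := by
  have r : ∀ k, derivedVec D G u v k = 0 := fun k => by rw [hV]; rfl
  have r0 := r 0; have r1 := r 1; have r2 := r 2; have r3 := r 3; have r4 := r 4; have r5 := r 5
  have r6 := r 6; have r7 := r 7; have r8 := r 8; have r9 := r 9; have r10 := r 10; have r11 := r 11
  have r12 := r 12; have r13 := r 13; have r14 := r 14; have r15 := r 15; have r16 := r 16
  have r17 := r 17; have r18 := r 18; have r19 := r 19; have r20 := r 20; have r21 := r 21
  simp only [derivedVec, Matrix.cons_val, Fm, Fp, Pi.add_apply, Pi.sub_apply] at r0 r1 r2 r3 r4 r5 r6 r7 r8 r9 r10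
  simp only [derivedVec, Matrix.cons_val, Fm, Fp, Pi.add_apply, Pi.sub_apply] at r11 r12 r13 r14 r15 r16 r17
  simp only [derivedVec, Matrix.cons_val, Fm, Fp, Pi.add_apply, Pi.sub_apply] at r18 r19 r20 r21
  funext k
  fin_cases k <;>
    simp only [derivedVec, Matrix.cons_val_zero', Matrix.cons_val_succ', Pi.zero_apply, Fm, Fp, Pi.add_apply,
      Pi.sub_apply]
  · linear_combination -r0
  · linear_combination -r1
  · linear_combination r2
  · linear_combination -r3
  · linear_combination -r4
  · linear_combination r5
  · linear_combination -r6
  · linear_combination r7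
  · linear_combination -r8
  · linear_combination -r9
  · linear_combination r10
  · linear_combination r11
  · linear_combination -r12
  · linear_combination -r13
  · linear_combination -r14
  · linear_combination -r15
  · linear_combination r16
  · linear_combination -r17
  · linear_combination r18
  · linear_combination -r19
  · linear_combination -r20
  · linear_combination r21

/-- **Equivalence.** Crossing symmetry of the fifteen flavoured orderings at `(u,v)` and at `(v,u)` (for all
admissible flavour configurations) is EQUIVALENT to the 22 derived equations at `(u,v)`.
[cite: ChesterEtAl2020, §2.1 ("we can find a set of seven crossing equations … 22 independent")] -/
theorem o2CrossingAt_iff_derivedVec :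
    (O2CrossingAt D G u v ∧ O2CrossingAt D G v u) ↔ derivedVec D G u v = 0 :=
  ⟨fun h => derivedVec_eq_zero h.1 h.2,
    fun hV => ⟨o2CrossingAt_of_derivedVec hV, o2CrossingAt_of_derivedVec (derivedVec_swap_eq_zero hV)⟩⟩

end Backward

/-! ## 7. One exchanged operator: the derived rows ARE one half of the quoted crossing vectors -/

section SingleOperator

/-- The channel sums of ONE exchanged `0⁺` multiplet of even spin with couplings `(a, b, c) = (λ_{ss𝒪}, λ_{φφ𝒪}, λ_{tt𝒪})`
and blocks `g_L` (`(−1)^ℓ = 1`): `𝒢^{φφφφ}_{0⁺} = b² g`, `𝒢^{tttt}_{0⁺} = c² g`, `𝒢^{ssss} = a² g`, `𝒢^{φφss} = ba·g`,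
`𝒢^{ttss} = ca·g`, `𝒢^{ttφφ}_{0⁺} = cb·g`, all other channels `0`. [cite: ChesterEtAl2020, §2.1 (eq. (4point), Table 1)] -/
def sec0p (a b c : ℝ) (g : Label → ℝ → ℝ → ℝ) : Sec → ℝ → ℝ → ℝ
  | .φφφφ0p, u, v => b ^ 2 * g .φφφφ u v
  | .φφφφ0m, _, _ => 0
  | .φφφφ2, _, _ => 0
  | .tttt0p, u, v => c ^ 2 * g .tttt u v
  | .tttt0m, _, _ => 0
  | .tttt4, _, _ => 0
  | .ssss0p, u, v => a ^ 2 * g .ssss u v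
  | .φφss0p, u, v => b * a * g .φφss u v
  | .sφφs1, _, _ => 0
  | .φsφs1, _, _ => 0
  | .ttss0p, u, v => c * a * g .ttss u v
  | .stts2, _, _ => 0
  | .tsts2, _, _ => 0
  | .ttφφ0p, u, v => c * b * g .ttφφ u v
  | .ttφφ0m, _, _ => 0
  | .φttφ1, _, _ => 0
  | .φttφ3, _, _ => 0
  | .tφtφ1, _, _ => 0
  | .tφtφ3, _, _ => 0
  | .φφst2, _, _ => 0
  | .sφφt1, _, _ => 0
  | .φsφt1, _, _ => 0

/-- ONE exchanged `0⁻` multiplet of odd spin, `(b, c) = (λ_{φφ𝒪}, λ_{tt𝒪})`, `(−1)^ℓ = −1`: `𝒢^{φφφφ}_{0⁻} = −b² g`,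
`𝒢^{tttt}_{0⁻} = −c² g`, `𝒢^{ttφφ}_{0⁻} = −cb·g`. [cite: ChesterEtAl2020, §2.1 (eq. (4point), Table 1)] -/
def sec0m (b c : ℝ) (g : Label → ℝ → ℝ → ℝ) : Sec → ℝ → ℝ → ℝ
  | .φφφφ0p, _, _ => 0
  | .φφφφ0m, u, v => -(b ^ 2 * g .φφφφ u v)
  | .φφφφ2, _, _ => 0
  | .tttt0p, _, _ => 0
  | .tttt0m, u, v => -(c ^ 2 * g .tttt u v)
  | .tttt4, _, _ => 0
  | .ssss0p, _, _ => 0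
  | .φφss0p, _, _ => 0
  | .sφφs1, _, _ => 0
  | .φsφs1, _, _ => 0
  | .ttss0p, _, _ => 0
  | .stts2, _, _ => 0
  | .tsts2, _, _ => 0
  | .ttφφ0p, _, _ => 0
  | .ttφφ0m, u, v => -(c * b * g .ttφφ u v)
  | .φttφ1, _, _ => 0
  | .φttφ3, _, _ => 0
  | .tφtφ1, _, _ => 0
  | .tφtφ3, _, _ => 0
  | .φφst2, _, _ => 0
  | .sφφt1, _, _ => 0
  | .φsφt1, _, _ => 0

/-- ONE exchanged charge-`1` multiplet of spin `ℓ`, `ε = (−1)^ℓ`, `(x, y) = (λ_{φs𝒪}, λ_{tφ𝒪})`, mirrored couplings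
`λ_{sφ𝒪} = εx`, `λ_{φt𝒪} = εy`: `𝒢^{φsφs} = εx² g`, `𝒢^{sφφs} = x² g`, `𝒢^{tφtφ}_1 = εy² g`, `𝒢^{φttφ}_1 = y² g`,
`𝒢^{φsφt} = xy·g`, `𝒢^{sφφt} = εxy·g`. [cite: ChesterEtAl2020, §2.1 (eq. (4point), Table 1)]
[cite: KosPolandSimmonsDuffinVichi2015, §2 (`λ_{ij𝒪} = (−1)^ℓ λ_{ji𝒪}`)] -/
def sec1 (x y ε : ℝ) (g : Label → ℝ → ℝ → ℝ) : Sec → ℝ → ℝ → ℝ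
  | .φφφφ0p, _, _ => 0
  | .φφφφ0m, _, _ => 0
  | .φφφφ2, _, _ => 0
  | .tttt0p, _, _ => 0
  | .tttt0m, _, _ => 0
  | .tttt4, _, _ => 0
  | .ssss0p, _, _ => 0
  | .φφss0p, _, _ => 0
  | .sφφs1, u, v => x ^ 2 * g .sφφs u v
  | .φsφs1, u, v => ε * x ^ 2 * g .φsφs u v
  | .ttss0p, _, _ => 0
  | .stts2, _, _ => 0
  | .tsts2, _, _ => 0
  | .ttφφ0p, _, _ => 0
  | .ttφφ0m, _, _ => 0
  | .φttφ1, u, v => y ^ 2 * g .φttφ u v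
  | .φttφ3, _, _ => 0
  | .tφtφ1, u, v => ε * y ^ 2 * g .tφtφ u v
  | .tφtφ3, _, _ => 0
  | .φφst2, _, _ => 0
  | .sφφt1, u, v => ε * (x * y) * g .sφφt u v
  | .φsφt1, u, v => x * y * g .φsφt u v

/-- ONE exchanged charge-`2` multiplet of even spin, `(b, z) = (λ_{φφ𝒪}, λ_{ts𝒪})`, `λ_{st𝒪} = z`: `𝒢^{φφφφ}_2 = b² g`,
`𝒢^{tsts} = z² g`, `𝒢^{stts} = z² g`, `𝒢^{φφst} = bz·g`. [cite: ChesterEtAl2020, §2.1 (eq. (4point), Table 1)] -/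
def sec2p (b z : ℝ) (g : Label → ℝ → ℝ → ℝ) : Sec → ℝ → ℝ → ℝ
  | .φφφφ0p, _, _ => 0
  | .φφφφ0m, _, _ => 0
  | .φφφφ2, u, v => b ^ 2 * g .φφφφ u v
  | .tttt0p, _, _ => 0
  | .tttt0m, _, _ => 0
  | .tttt4, _, _ => 0
  | .ssss0p, _, _ => 0
  | .φφss0p, _, _ => 0
  | .sφφs1, _, _ => 0
  | .φsφs1, _, _ => 0
  | .ttss0p, _, _ => 0
  | .stts2, u, v => z ^ 2 * g .stts u v
  | .tsts2, u, v => z ^ 2 * g .tsts u v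
  | .ttφφ0p, _, _ => 0
  | .ttφφ0m, _, _ => 0
  | .φttφ1, _, _ => 0
  | .φttφ3, _, _ => 0
  | .tφtφ1, _, _ => 0
  | .tφtφ3, _, _ => 0
  | .φφst2, u, v => b * z * g .φφst u v
  | .sφφt1, _, _ => 0
  | .φsφt1, _, _ => 0

/-- ONE exchanged charge-`2` multiplet of odd spin with weight `p = λ_{ts𝒪}²` (`λ_{φφ𝒪} = 0`, `λ_{st𝒪} = −λ_{ts𝒪}`,
`(−1)^ℓ = −1`): `𝒢^{tsts} = −p·g`, `𝒢^{stts} = p·g`. [cite: ChesterEtAl2020, §2.1 (eq. (4point), Table 1)] -/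
def sec2m (p : ℝ) (g : Label → ℝ → ℝ → ℝ) : Sec → ℝ → ℝ → ℝ
  | .φφφφ0p, _, _ => 0
  | .φφφφ0m, _, _ => 0
  | .φφφφ2, _, _ => 0
  | .tttt0p, _, _ => 0
  | .tttt0m, _, _ => 0
  | .tttt4, _, _ => 0
  | .ssss0p, _, _ => 0
  | .φφss0p, _, _ => 0
  | .sφφs1, _, _ => 0
  | .φsφs1, _, _ => 0
  | .ttss0p, _, _ => 0
  | .stts2, u, v => p * g .stts u v
  | .tsts2, u, v => -(p * g .tsts u v)
  | .ttφφ0p, _, _ => 0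
  | .ttφφ0m, _, _ => 0
  | .φttφ1, _, _ => 0
  | .φttφ3, _, _ => 0
  | .tφtφ1, _, _ => 0
  | .tφtφ3, _, _ => 0
  | .φφst2, _, _ => 0
  | .sφφt1, _, _ => 0
  | .φsφt1, _, _ => 0

/-- ONE exchanged charge-`3` multiplet of spin `ℓ` with weight `p = λ_{tφ𝒪}²`, `ε = (−1)^ℓ`, `λ_{φt𝒪} = ελ_{tφ𝒪}`:
`𝒢^{tφtφ}_3 = εp·g`, `𝒢^{φttφ}_3 = p·g`. [cite: ChesterEtAl2020, §2.1 (eq. (4point), Table 1)] -/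
def sec3 (p ε : ℝ) (g : Label → ℝ → ℝ → ℝ) : Sec → ℝ → ℝ → ℝ
  | .φφφφ0p, _, _ => 0
  | .φφφφ0m, _, _ => 0
  | .φφφφ2, _, _ => 0
  | .tttt0p, _, _ => 0
  | .tttt0m, _, _ => 0
  | .tttt4, _, _ => 0
  | .ssss0p, _, _ => 0
  | .φφss0p, _, _ => 0
  | .sφφs1, _, _ => 0
  | .φsφs1, _, _ => 0
  | .ttss0p, _, _ => 0
  | .stts2, _, _ => 0
  | .tsts2, _, _ => 0
  | .ttφφ0p, _, _ => 0
  | .ttφφ0m, _, _ => 0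
  | .φttφ1, _, _ => 0
  | .φttφ3, u, v => p * g .φttφ u v
  | .tφtφ1, _, _ => 0
  | .tφtφ3, u, v => ε * p * g .tφtφ u v
  | .φφst2, _, _ => 0
  | .sφφt1, _, _ => 0
  | .φsφt1, _, _ => 0

/-- ONE exchanged charge-`4` multiplet (even spin) with weight `p = λ_{tt𝒪}²`: `𝒢^{tttt}_4 = p·g`.
[cite: ChesterEtAl2020, §2.1 (eq. (4point), Table 1)] -/
def sec4 (p : ℝ) (g : Label → ℝ → ℝ → ℝ) : Sec → ℝ → ℝ → ℝ
  | .φφφφ0p, _, _ => 0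
  | .φφφφ0m, _, _ => 0
  | .φφφφ2, _, _ => 0
  | .tttt0p, _, _ => 0
  | .tttt0m, _, _ => 0
  | .tttt4, u, v => p * g .tttt u v
  | .ssss0p, _, _ => 0
  | .φφss0p, _, _ => 0
  | .sφφs1, _, _ => 0
  | .φsφs1, _, _ => 0
  | .ttss0p, _, _ => 0
  | .stts2, _, _ => 0
  | .tsts2, _, _ => 0
  | .ttφφ0p, _, _ => 0
  | .ttφφ0m, _, _ => 0
  | .φttφ1, _, _ => 0
  | .φttφ3, _, _ => 0
  | .tφtφ1, _, _ => 0
  | .tφtφ3, _, _ => 0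
  | .φφst2, _, _ => 0
  | .sφφt1, _, _ => 0
  | .φsφt1, _, _ => 0

variable (D : Dims) (g : Label → ℝ → ℝ → ℝ) (u v : ℝ)

/-- **`0⁺`: the quoted summand `(a b c) V⃗_{0⁺} (a b c)ᵀ` is twice the derived vector of the single-multiplet channel
sums.** [cite: ChesterEtAl2020, App. «Crossing vectors» (`V⃗_{0⁺,Δ,ℓ⁺}`)] -/
theorem quad0p_eq_two_smul_derivedVec (a b c : ℝ) :
    quad0p D a b c g u v = (2 : ℝ) • derivedVec D (sec0p a b c g) u v := by
  rw [quad0p_eq]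
  funext r
  fin_cases r <;>
    simp only [derivedVec, sec0p, Matrix.cons_val_zero', Matrix.cons_val_succ', Pi.smul_apply, smul_eq_mul,
      Fminus, Fplus, Dims.expo, Fm, Fp, Pi.add_apply, Pi.sub_apply] <;> ring

/-- **`0⁻`.** [cite: ChesterEtAl2020, App. «Crossing vectors» (`V⃗_{0⁻,Δ,ℓ⁻}`)] -/
theorem quad0m_eq_two_smul_derivedVec (b c : ℝ) :
    quad0m D b c g u v = (2 : ℝ) • derivedVec D (sec0m b c g) u v := by
  rw [quad0m_eq]
  funext r
  fin_cases r <;>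
    simp only [derivedVec, sec0m, Matrix.cons_val_zero', Matrix.cons_val_succ', Pi.smul_apply, smul_eq_mul,
      Fminus, Fplus, Dims.expo, Fm, Fp, Pi.add_apply, Pi.sub_apply] <;> ring

/-- **Charge `1`.** [cite: ChesterEtAl2020, App. «Crossing vectors» (`V⃗_{1,Δ,ℓ}`)] -/
theorem quad1_eq_two_smul_derivedVec (x y ε : ℝ) :
    quad1 D x y ε g u v = (2 : ℝ) • derivedVec D (sec1 x y ε g) u v := by
  rw [quad1_eq]
  funext r
  fin_cases r <;>
    simp only [derivedVec, sec1, Matrix.cons_val_zero', Matrix.cons_val_succ', Pi.smul_apply, smul_eq_mul,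
      Fminus, Fplus, Dims.expo, Fm, Fp, Pi.add_apply, Pi.sub_apply] <;> ring

/-- **Charge `2`, even spin.** [cite: ChesterEtAl2020, App. «Crossing vectors» (`V⃗_{2,Δ,ℓ⁺}`)] -/
theorem quad2p_eq_two_smul_derivedVec (b z : ℝ) :
    quad2p D b z g u v = (2 : ℝ) • derivedVec D (sec2p b z g) u v := by
  rw [quad2p_eq]
  funext r
  fin_cases r <;>
    simp only [derivedVec, sec2p, Matrix.cons_val_zero', Matrix.cons_val_succ', Pi.smul_apply, smul_eq_mul,
      Fminus, Fplus, Dims.expo, Fm, Fp, Pi.add_apply, Pi.sub_apply] <;> ring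

/-- **Charge `2`, odd spin** (weight `p = λ²_{ts𝒪}`). [cite: ChesterEtAl2020, App. «Crossing vectors» (`V⃗_{2,Δ,ℓ⁻}`)] -/
theorem V2m_eq_two_smul_derivedVec (p : ℝ) :
    p • V2m D g u v = (2 : ℝ) • derivedVec D (sec2m p g) u v := by
  funext r
  fin_cases r <;>
    simp only [V2m, derivedVec, sec2m, Matrix.cons_val_zero', Matrix.cons_val_succ', Pi.smul_apply,
      smul_eq_mul, Fminus, Fplus, Dims.expo, Fm, Fp, Pi.add_apply, Pi.sub_apply] <;> ring

/-- **Charge `3`** (weight `p = λ²_{tφ𝒪}`). [cite: ChesterEtAl2020, App. «Crossing vectors» (`V⃗_{3,Δ,ℓ}`)] -/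
theorem V3_eq_two_smul_derivedVec (p ε : ℝ) :
    p • V3 D ε g u v = (2 : ℝ) • derivedVec D (sec3 p ε g) u v := by
  funext r
  fin_cases r <;>
    simp only [V3, derivedVec, sec3, Matrix.cons_val_zero', Matrix.cons_val_succ', Pi.smul_apply,
      smul_eq_mul, Fminus, Fplus, Dims.expo, Fm, Fp, Pi.add_apply, Pi.sub_apply] <;> ring

/-- **Charge `4`** (weight `p = λ²_{tt𝒪}`). [cite: ChesterEtAl2020, App. «Crossing vectors» (`V⃗_{4,Δ,ℓ⁺}`)] -/
theorem V4_eq_two_smul_derivedVec (p : ℝ) :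
    p • V4 D g u v = (2 : ℝ) • derivedVec D (sec4 p g) u v := by
  funext r
  fin_cases r <;>
    simp only [V4, derivedVec, sec4, Matrix.cons_val_zero', Matrix.cons_val_succ', Pi.smul_apply,
      smul_eq_mul, Fminus, Fplus, Dims.expo, Fm, Fp, Pi.add_apply, Pi.sub_apply] <;> ring

end SingleOperator

/-! ## 8. Linearity and termwise summation of the derived rows -/

section Sums
variable {D : Dims} {u v : ℝ}

/-- The derived rows are additive in the channel sums (eq. (4point) is a sum over exchanged operators).
[cite: ChesterEtAl2020, §2.1 (eq. (4point))] -/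
theorem derivedVec_add (G G' : Sec → ℝ → ℝ → ℝ) :
    derivedVec D (G + G') u v = derivedVec D G u v + derivedVec D G' u v := by
  funext r
  fin_cases r <;>
    simp only [derivedVec, Matrix.cons_val_zero', Matrix.cons_val_succ', Pi.add_apply, Pi.sub_apply, Fm, Fp] <;>
    ring

/-- The derived rows are homogeneous in the channel sums. [cite: ChesterEtAl2020, §2.1 (eq. (4point))] -/
theorem derivedVec_smul (a : ℝ) (G : Sec → ℝ → ℝ → ℝ) :
    derivedVec D (a • G) u v = a • derivedVec D G u v := by
  funext r
  fin_cases r <;>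
    simp only [derivedVec, Matrix.cons_val_zero', Matrix.cons_val_succ', Pi.add_apply, Pi.sub_apply,
      Pi.smul_apply, smul_eq_mul, Fm, Fp] <;>
    ring

variable {ι : Type*} {F : ι → Sec → ℝ → ℝ → ℝ} {Gt : Sec → ℝ → ℝ → ℝ}

/-- `F_-` of a pointwise channel sum is the sum of the `F_-` (finite linear combination of two point values).
[cite: KosPolandSimmonsDuffinVichi2015, §2 (`F^{ij,kl}_∓`)] -/
theorem hasSum_Fm₀ {g : ι → ℝ → ℝ → ℝ} {G₀ : ℝ → ℝ → ℝ} (Δ u v : ℝ)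
    (h1 : HasSum (fun o => g o u v) (G₀ u v)) (h2 : HasSum (fun o => g o v u) (G₀ v u)) :
    HasSum (fun o => Fm Δ (g o) u v) (Fm Δ G₀ u v) := by
  simp only [Fm]
  exact (h1.mul_left _).sub (h2.mul_left _)

/-- `F_+` of a pointwise channel sum is the sum of the `F_+`. [cite: KosPolandSimmonsDuffinVichi2015, §2 (`F^{ij,kl}_∓`)] -/
theorem hasSum_Fp₀ {g : ι → ℝ → ℝ → ℝ} {G₀ : ℝ → ℝ → ℝ} (Δ u v : ℝ)
    (h1 : HasSum (fun o => g o u v) (G₀ u v)) (h2 : HasSum (fun o => g o v u) (G₀ v u)) :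
    HasSum (fun o => Fp Δ (g o) u v) (Fp Δ G₀ u v) := by
  simp only [Fp]
  exact (h1.mul_left _).add (h2.mul_left _)

/-- **Termwise summation.** If the channel sums of a family of contributions converge channel by channel at the
two points `(u,v)` and `(v,u)` to those of `Gt`, the derived rows at `(u,v)` converge to the derived rows of `Gt`
(each row is a finite linear combination of these point values).
[cite: ChesterEtAl2020, §2.1 (eq. (4point): sum over exchanged operators)] -/
theorem hasSum_derivedVec (h1 : ∀ σ, HasSum (fun o => F o σ u v) (Gt σ u v))
    (h2 : ∀ σ, HasSum (fun o => F o σ v u) (Gt σ v u)) (r : Fin 22) :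
    HasSum (fun o => derivedVec D (F o) u v r) (derivedVec D Gt u v r) := by
  have hs1 : ∀ σ σ', HasSum (fun o => (F o σ - F o σ') u v) ((Gt σ - Gt σ') u v) :=
    fun σ σ' => (h1 σ).sub (h1 σ')
  have hs2 : ∀ σ σ', HasSum (fun o => (F o σ - F o σ') v u) ((Gt σ - Gt σ') v u) :=
    fun σ σ' => (h2 σ).sub (h2 σ')
  have ha1 : ∀ σ σ', HasSum (fun o => (F o σ + F o σ') u v) ((Gt σ + Gt σ') u v) :=
    fun σ σ' => (h1 σ).add (h1 σ')
  have ha2 : ∀ σ σ', HasSum (fun o => (F o σ + F o σ') v u) ((Gt σ + Gt σ') v u) :=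
    fun σ σ' => (h2 σ).add (h2 σ')
  fin_cases r <;> simp only [derivedVec, Matrix.cons_val_zero', Matrix.cons_val_succ']
  · exact hasSum_Fm₀ _ u v (hs1 _ _) (hs2 _ _)
  · exact (hasSum_Fm₀ _ u v (h1 _) (h2 _)).add ((hasSum_Fm₀ _ u v (h1 _) (h2 _)).mul_left 2)
  · exact (hasSum_Fp₀ _ u v (h1 _) (h2 _)).sub (hasSum_Fp₀ _ u v (ha1 _ _) (ha2 _ _))
  · exact hasSum_Fm₀ _ u v (hs1 _ _) (hs2 _ _)
  · exact (hasSum_Fm₀ _ u v (h1 _) (h2 _)).add ((hasSum_Fm₀ _ u v (h1 _) (h2 _)).mul_left 2)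
  · exact (hasSum_Fp₀ _ u v (h1 _) (h2 _)).sub (hasSum_Fp₀ _ u v (ha1 _ _) (ha2 _ _))
  · exact hasSum_Fm₀ _ u v (ha1 _ _) (ha2 _ _)
  · exact (hasSum_Fp₀ _ u v (h1 _) (h2 _)).sub (hasSum_Fp₀ _ u v (h1 _) (h2 _))
  · exact (hasSum_Fm₀ _ u v (ha1 _ _) (ha2 _ _)).add (hasSum_Fm₀ _ u v (h1 _) (h2 _))
  · exact (hasSum_Fm₀ _ u v (hs1 _ _) (hs2 _ _)).add (hasSum_Fm₀ _ u v (h1 _) (h2 _))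
  · exact (hasSum_Fp₀ _ u v (h1 _) (h2 _)).sub (hasSum_Fp₀ _ u v (ha1 _ _) (ha2 _ _))
  · exact (hasSum_Fp₀ _ u v (h1 _) (h2 _)).sub (hasSum_Fp₀ _ u v (hs1 _ _) (hs2 _ _))
  · exact hasSum_Fm₀ _ u v (h1 _) (h2 _)
  · exact hasSum_Fm₀ _ u v (h1 _) (h2 _)
  · exact hasSum_Fm₀ _ u v (h1 _) (h2 _)
  · exact (hasSum_Fm₀ _ u v (h1 _) (h2 _)).add (hasSum_Fm₀ _ u v (h1 _) (h2 _))
  · exact (hasSum_Fp₀ _ u v (h1 _) (h2 _)).sub (hasSum_Fp₀ _ u v (h1 _) (h2 _))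
  · exact (hasSum_Fm₀ _ u v (h1 _) (h2 _)).add (hasSum_Fm₀ _ u v (h1 _) (h2 _))
  · exact (hasSum_Fp₀ _ u v (h1 _) (h2 _)).sub (hasSum_Fp₀ _ u v (h1 _) (h2 _))
  · exact hasSum_Fm₀ _ u v (h1 _) (h2 _)
  · exact (hasSum_Fm₀ _ u v (h1 _) (h2 _)).add (hasSum_Fm₀ _ u v (h1 _) (h2 _))
  · exact (hasSum_Fp₀ _ u v (h1 _) (h2 _)).sub (hasSum_Fp₀ _ u v (h1 _) (h2 _))

/-- Vector form of `hasSum_derivedVec`. [cite: ChesterEtAl2020, §2.1 (eq. (4point): sum over exchanged operators)] -/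
theorem hasSum_derivedVec' (h1 : ∀ σ, HasSum (fun o => F o σ u v) (Gt σ u v))
    (h2 : ∀ σ, HasSum (fun o => F o σ v u) (Gt σ v u)) :
    HasSum (fun o => derivedVec D (F o) u v) (derivedVec D Gt u v) :=
  Pi.hasSum.2 fun r => hasSum_derivedVec h1 h2 r

/-- **The crossing equation, derived.** If the total channel sums `Gt` are crossing symmetric in flavour space at
`(u,v)` and `(v,u)` and are, at these two points, the channel-by-channel sums of a family of contributions, then
the derived 22-vectors of the contributions sum to zero at `(u,v)`.
[cite: ChesterEtAl2020, §2.1 (crossing equations)] -/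
theorem hasSum_derivedVec_zero (hc : O2CrossingAt D Gt u v) (hc' : O2CrossingAt D Gt v u)
    (h1 : ∀ σ, HasSum (fun o => F o σ u v) (Gt σ u v)) (h2 : ∀ σ, HasSum (fun o => F o σ v u) (Gt σ v u)) :
    HasSum (fun o => derivedVec D (F o) u v) 0 := by
  rw [← derivedVec_eq_zero hc hc']
  exact hasSum_derivedVec' h1 h2

end Sums

/-! ## 9. Assembly: the grouped crossing equation of §3.1 and the exclusion step from flavour-space crossing -/

section Assembly
variable (D : Dims)

/-- The total channel sums of a hypothetical spectrum, GROUPED as in §3.1–§3.2: the unit operator (a `0⁺` scalar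
with `(λ_{ss1}, λ_{φφ1}, λ_{tt1}) = (1, 1, 1)` and unit blocks), the three externals `s` (`0⁺`, couplings
`(λ_{sss}, λ_{φφs}, λ_{tts}) = (l₀, l₁, l₂)`, blocks `gs`), `φ` (charge `1`, `(λ_{φsφ}, λ_{tφφ}) = (l₁, l₃)`,
`ε = 1`, blocks `gφ`), `t` (charge `2⁺`, `(λ_{φφt}, λ_{tst}) = (l₃, l₂)`, blocks `gt`), and the channel sums
`S0p, …, S4` of everything else, sector by sector. [cite: ChesterEtAl2020, §3.1–§3.2 (unit, `λ_ext`, `V⃗_ext`)] -/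
def totalSums (l : Fin 4 → ℝ) (gs gφ gt : Label → ℝ → ℝ → ℝ) (S0p S0m S1 S2p S2m S3 S4 : Sec → ℝ → ℝ → ℝ) :
    Sec → ℝ → ℝ → ℝ :=
  sec0p 1 1 1 unitBlocks + (sec0p (l 0) (l 1) (l 2) gs + sec1 (l 1) (l 3) 1 gφ + sec2p (l 3) (l 2) gt) +
    S0p + S0m + S1 + S2p + S2m + S3 + S4

variable {D}
variable {ι0p ι0m ι1 ι2p ι2m ι3 ι4 : Type*}
  {a0 b0 c0 : ι0p → ℝ} {g0p : ι0p → Label → ℝ → ℝ → ℝ}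
  {b0m c0m : ι0m → ℝ} {g0m : ι0m → Label → ℝ → ℝ → ℝ}
  {x1 y1 ε1 : ι1 → ℝ} {g1 : ι1 → Label → ℝ → ℝ → ℝ}
  {b2 z2 : ι2p → ℝ} {g2p : ι2p → Label → ℝ → ℝ → ℝ}
  {p2m : ι2m → ℝ} {g2m : ι2m → Label → ℝ → ℝ → ℝ}
  {p3 ε3 : ι3 → ℝ} {g3 : ι3 → Label → ℝ → ℝ → ℝ}
  {p4 : ι4 → ℝ} {g4 : ι4 → Label → ℝ → ℝ → ℝ}
  {lam : Fin 4 → ℝ} {gs gφ gt : Label → ℝ → ℝ → ℝ}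
  {S0p S0m S1 S2p S2m S3 S4 : Sec → ℝ → ℝ → ℝ}

/-- **The grouped crossing equation of §3.1, derived at a point pair.**  Data: the seven families of exchanged
multiplets other than the unit and the externals, with couplings and blocks as in `false_of_functional₂₂`, whose
channel sums converge channel by channel at `(u,v)` and `(v,u)` to `S0p, …, S4`; `λ_ext = lam` and the blocks of
the externals.  Hypothesis: the grouped total channel sums `totalSums` are crossing symmetric in flavour space at
`(u,v)` and `(v,u)`.  Conclusions: each sector's series of QUOTED crossing vectors
(`quad0p, quad0m, quad1, quad2p, p • V2m, p • V3, p • V4` of `O2ThreeScalarCrossing`) converges at `(u,v)`, to twice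
the derived vector of the sector's channel sums, and
`quad0p D 1 1 1 unitBlocks + λ_extᵀ V⃗_ext λ_ext + Σ_sectors = 0` at `(u,v)` — the hypothesis `hx` of
`false_of_pointFunctional₂₂`. [cite: ChesterEtAl2020, §2.1 (crossing equations), §3.1–§3.2 (grouping: unit, `V⃗_ext`)] -/
theorem crossingEq_of_flavourCrossing {u v : ℝ}
    (h0p : (∀ σ, HasSum (fun o => sec0p (a0 o) (b0 o) (c0 o) (g0p o) σ u v) (S0p σ u v)) ∧
      ∀ σ, HasSum (fun o => sec0p (a0 o) (b0 o) (c0 o) (g0p o) σ v u) (S0p σ v u))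
    (h0m : (∀ σ, HasSum (fun o => sec0m (b0m o) (c0m o) (g0m o) σ u v) (S0m σ u v)) ∧
      ∀ σ, HasSum (fun o => sec0m (b0m o) (c0m o) (g0m o) σ v u) (S0m σ v u))
    (h1 : (∀ σ, HasSum (fun o => sec1 (x1 o) (y1 o) (ε1 o) (g1 o) σ u v) (S1 σ u v)) ∧
      ∀ σ, HasSum (fun o => sec1 (x1 o) (y1 o) (ε1 o) (g1 o) σ v u) (S1 σ v u))
    (h2p : (∀ σ, HasSum (fun o => sec2p (b2 o) (z2 o) (g2p o) σ u v) (S2p σ u v)) ∧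
      ∀ σ, HasSum (fun o => sec2p (b2 o) (z2 o) (g2p o) σ v u) (S2p σ v u))
    (h2m : (∀ σ, HasSum (fun o => sec2m (p2m o) (g2m o) σ u v) (S2m σ u v)) ∧
      ∀ σ, HasSum (fun o => sec2m (p2m o) (g2m o) σ v u) (S2m σ v u))
    (h3 : (∀ σ, HasSum (fun o => sec3 (p3 o) (ε3 o) (g3 o) σ u v) (S3 σ u v)) ∧
      ∀ σ, HasSum (fun o => sec3 (p3 o) (ε3 o) (g3 o) σ v u) (S3 σ v u))
    (h4 : (∀ σ, HasSum (fun o => sec4 (p4 o) (g4 o) σ u v) (S4 σ u v)) ∧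
      ∀ σ, HasSum (fun o => sec4 (p4 o) (g4 o) σ v u) (S4 σ v u))
    (hc : O2CrossingAt D (totalSums lam gs gφ gt S0p S0m S1 S2p S2m S3 S4) u v)
    (hc' : O2CrossingAt D (totalSums lam gs gφ gt S0p S0m S1 S2p S2m S3 S4) v u) :
    HasSum (fun o => quad0p D (a0 o) (b0 o) (c0 o) (g0p o) u v) ((2 : ℝ) • derivedVec D S0p u v) ∧
    HasSum (fun o => quad0m D (b0m o) (c0m o) (g0m o) u v) ((2 : ℝ) • derivedVec D S0m u v) ∧
    HasSum (fun o => quad1 D (x1 o) (y1 o) (ε1 o) (g1 o) u v) ((2 : ℝ) • derivedVec D S1 u v) ∧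
    HasSum (fun o => quad2p D (b2 o) (z2 o) (g2p o) u v) ((2 : ℝ) • derivedVec D S2p u v) ∧
    HasSum (fun o => p2m o • V2m D (g2m o) u v) ((2 : ℝ) • derivedVec D S2m u v) ∧
    HasSum (fun o => p3 o • V3 D (ε3 o) (g3 o) u v) ((2 : ℝ) • derivedVec D S3 u v) ∧
    HasSum (fun o => p4 o • V4 D (g4 o) u v) ((2 : ℝ) • derivedVec D S4 u v) ∧
    quad0p D 1 1 1 unitBlocks u v + quadVext D lam gs gφ gt u v +
      (2 : ℝ) • derivedVec D S0p u v + (2 : ℝ) • derivedVec D S0m u v + (2 : ℝ) • derivedVec D S1 u v +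
      (2 : ℝ) • derivedVec D S2p u v + (2 : ℝ) • derivedVec D S2m u v + (2 : ℝ) • derivedVec D S3 u v +
      (2 : ℝ) • derivedVec D S4 u v = 0 := by
  refine ⟨?_, ?_, ?_, ?_, ?_, ?_, ?_, ?_⟩
  · have e : (fun o => quad0p D (a0 o) (b0 o) (c0 o) (g0p o) u v) =
        fun o => (2 : ℝ) • derivedVec D (sec0p (a0 o) (b0 o) (c0 o) (g0p o)) u v :=
      funext fun o => quad0p_eq_two_smul_derivedVec D (g0p o) u v (a0 o) (b0 o) (c0 o)
    rw [e]; exact (hasSum_derivedVec' h0p.1 h0p.2).const_smul _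
  · have e : (fun o => quad0m D (b0m o) (c0m o) (g0m o) u v) =
        fun o => (2 : ℝ) • derivedVec D (sec0m (b0m o) (c0m o) (g0m o)) u v :=
      funext fun o => quad0m_eq_two_smul_derivedVec D (g0m o) u v (b0m o) (c0m o)
    rw [e]; exact (hasSum_derivedVec' h0m.1 h0m.2).const_smul _
  · have e : (fun o => quad1 D (x1 o) (y1 o) (ε1 o) (g1 o) u v) =
        fun o => (2 : ℝ) • derivedVec D (sec1 (x1 o) (y1 o) (ε1 o) (g1 o)) u v :=
      funext fun o => quad1_eq_two_smul_derivedVec D (g1 o) u v (x1 o) (y1 o) (ε1 o)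
    rw [e]; exact (hasSum_derivedVec' h1.1 h1.2).const_smul _
  · have e : (fun o => quad2p D (b2 o) (z2 o) (g2p o) u v) =
        fun o => (2 : ℝ) • derivedVec D (sec2p (b2 o) (z2 o) (g2p o)) u v :=
      funext fun o => quad2p_eq_two_smul_derivedVec D (g2p o) u v (b2 o) (z2 o)
    rw [e]; exact (hasSum_derivedVec' h2p.1 h2p.2).const_smul _
  · have e : (fun o => p2m o • V2m D (g2m o) u v) =
        fun o => (2 : ℝ) • derivedVec D (sec2m (p2m o) (g2m o)) u v :=
      funext fun o => V2m_eq_two_smul_derivedVec D (g2m o) u v (p2m o)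
    rw [e]; exact (hasSum_derivedVec' h2m.1 h2m.2).const_smul _
  · have e : (fun o => p3 o • V3 D (ε3 o) (g3 o) u v) =
        fun o => (2 : ℝ) • derivedVec D (sec3 (p3 o) (ε3 o) (g3 o)) u v :=
      funext fun o => V3_eq_two_smul_derivedVec D (g3 o) u v (p3 o) (ε3 o)
    rw [e]; exact (hasSum_derivedVec' h3.1 h3.2).const_smul _
  · have e : (fun o => p4 o • V4 D (g4 o) u v) =
        fun o => (2 : ℝ) • derivedVec D (sec4 (p4 o) (g4 o)) u v :=
      funext fun o => V4_eq_two_smul_derivedVec D (g4 o) u v (p4 o)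
    rw [e]; exact (hasSum_derivedVec' h4.1 h4.2).const_smul _
  · have hV := derivedVec_eq_zero hc hc'
    simp only [totalSums, derivedVec_add] at hV
    rw [quadVext_eq_parts]
    simp only [Pi.add_apply, quad0p_eq_two_smul_derivedVec, quad1_eq_two_smul_derivedVec,
      quad2p_eq_two_smul_derivedVec, ← smul_add, hV, smul_zero]

/-- **Exclusion from first principles (point functionals).**  Data as in `crossingEq_of_flavourCrossing` at
finitely many evaluation points `(u_m, v_m)`; hypotheses: channel-by-channel convergence of each sector at every
`(u_m, v_m)` and `(v_m, u_m)`, flavour-space crossing symmetry of the grouped total channel sums there, and the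
§3.1 conditions on `α = pointFunctional₂₂ w u v` with the weaker §3.2 condition at a representative `l` of the class
of `λ_ext = c l`.  Conclusion: contradiction — `false_of_pointFunctional₂₂` with its crossing-equation hypotheses
`h0p … h4, hx` DISCHARGED by the derivation of this file.
[cite: ChesterEtAl2020, §3.1 (functional conditions; "the hypothetical spectrum is ruled out"), §3.2 (weaker condition)] -/
theorem false_of_pointFunctional₂₂_of_flavourCrossing {M : ℕ} (w : Fin M → Fin 22 → ℝ) (u v : Fin M → ℝ)
    {l : Fin 4 → ℝ} {c : ℝ}
    (hp2m : ∀ o, 0 ≤ p2m o) (hp3 : ∀ o, 0 ≤ p3 o) (hp4 : ∀ o, 0 ≤ p4 o)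
    (h0p : ∀ m, (∀ σ, HasSum (fun o => sec0p (a0 o) (b0 o) (c0 o) (g0p o) σ (u m) (v m)) (S0p σ (u m) (v m))) ∧
      ∀ σ, HasSum (fun o => sec0p (a0 o) (b0 o) (c0 o) (g0p o) σ (v m) (u m)) (S0p σ (v m) (u m)))
    (h0m : ∀ m, (∀ σ, HasSum (fun o => sec0m (b0m o) (c0m o) (g0m o) σ (u m) (v m)) (S0m σ (u m) (v m))) ∧
      ∀ σ, HasSum (fun o => sec0m (b0m o) (c0m o) (g0m o) σ (v m) (u m)) (S0m σ (v m) (u m)))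
    (h1 : ∀ m, (∀ σ, HasSum (fun o => sec1 (x1 o) (y1 o) (ε1 o) (g1 o) σ (u m) (v m)) (S1 σ (u m) (v m))) ∧
      ∀ σ, HasSum (fun o => sec1 (x1 o) (y1 o) (ε1 o) (g1 o) σ (v m) (u m)) (S1 σ (v m) (u m)))
    (h2p : ∀ m, (∀ σ, HasSum (fun o => sec2p (b2 o) (z2 o) (g2p o) σ (u m) (v m)) (S2p σ (u m) (v m))) ∧
      ∀ σ, HasSum (fun o => sec2p (b2 o) (z2 o) (g2p o) σ (v m) (u m)) (S2p σ (v m) (u m)))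
    (h2m : ∀ m, (∀ σ, HasSum (fun o => sec2m (p2m o) (g2m o) σ (u m) (v m)) (S2m σ (u m) (v m))) ∧
      ∀ σ, HasSum (fun o => sec2m (p2m o) (g2m o) σ (v m) (u m)) (S2m σ (v m) (u m)))
    (h3 : ∀ m, (∀ σ, HasSum (fun o => sec3 (p3 o) (ε3 o) (g3 o) σ (u m) (v m)) (S3 σ (u m) (v m))) ∧
      ∀ σ, HasSum (fun o => sec3 (p3 o) (ε3 o) (g3 o) σ (v m) (u m)) (S3 σ (v m) (u m)))
    (h4 : ∀ m, (∀ σ, HasSum (fun o => sec4 (p4 o) (g4 o) σ (u m) (v m)) (S4 σ (u m) (v m))) ∧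
      ∀ σ, HasSum (fun o => sec4 (p4 o) (g4 o) σ (v m) (u m)) (S4 σ (v m) (u m)))
    (hc : ∀ m, O2CrossingAt D (totalSums lam gs gφ gt S0p S0m S1 S2p S2m S3 S4) (u m) (v m) ∧
      O2CrossingAt D (totalSums lam gs gφ gt S0p S0m S1 S2p S2m S3 S4) (v m) (u m))
    (hunit : 0 < ![(1 : ℝ), 1, 1] ⬝ᵥ
      (alphaMat (pointFunctional₂₂ w u v) (V0p D unitBlocks) *ᵥ ![(1 : ℝ), 1, 1]))
    (hext : 0 ≤ l ⬝ᵥ (alphaMat (pointFunctional₂₂ w u v) (Vext D gs gφ gt) *ᵥ l)) (hlam : lam = c • l)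
    (hpos0p : ∀ o, (alphaMat (pointFunctional₂₂ w u v) (V0p D (g0p o))).PosSemidef)
    (hpos0m : ∀ o, (alphaMat (pointFunctional₂₂ w u v) (V0m D (g0m o))).PosSemidef)
    (hpos1 : ∀ o, (alphaMat (pointFunctional₂₂ w u v) (V1 D (ε1 o) (g1 o))).PosSemidef)
    (hpos2p : ∀ o, (alphaMat (pointFunctional₂₂ w u v) (V2p D (g2p o))).PosSemidef)
    (hpos2m : ∀ o, 0 ≤ pointFunctional₂₂ w u v (V2m D (g2m o)))
    (hpos3 : ∀ o, 0 ≤ pointFunctional₂₂ w u v (V3 D (ε3 o) (g3 o)))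
    (hpos4 : ∀ o, 0 ≤ pointFunctional₂₂ w u v (V4 D (g4 o))) : False := by
  have key := fun m =>
    crossingEq_of_flavourCrossing (D := D) (h0p m) (h0m m) (h1 m) (h2p m) (h2m m) (h3 m) (h4 m) (hc m).1 (hc m).2
  exact false_of_pointFunctional₂₂ w u v D
    (T0p := fun x y => (2 : ℝ) • derivedVec D S0p x y) (T0m := fun x y => (2 : ℝ) • derivedVec D S0m x y)
    (T1 := fun x y => (2 : ℝ) • derivedVec D S1 x y) (T2p := fun x y => (2 : ℝ) • derivedVec D S2p x y)
    (T2m := fun x y => (2 : ℝ) • derivedVec D S2m x y) (T3 := fun x y => (2 : ℝ) • derivedVec D S3 x y)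
    (T4 := fun x y => (2 : ℝ) • derivedVec D S4 x y)
    hp2m hp3 hp4 (fun m => (key m).1) (fun m => (key m).2.1) (fun m => (key m).2.2.1)
    (fun m => (key m).2.2.2.1) (fun m => (key m).2.2.2.2.1) (fun m => (key m).2.2.2.2.2.1)
    (fun m => (key m).2.2.2.2.2.2.1) (fun m => (key m).2.2.2.2.2.2.2) hunit hext hlam hpos0p hpos0m hpos1
    hpos2p hpos2m hpos3 hpos4

end Assembly

/-! ## 10. The link to the axioms object: `O2Data.SatisfiesCrossing` from flavour-space crossing -/

section System
open Set
open Literature.MathematicalPhysics.QuantumFieldTheory.O2ThreeScalarSystem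

/-- **Flavour-space crossing of an `O(2)` three-scalar datum at a point pair.**  For `X : O2Data` (the datum of
`O2ThreeScalarSystem.lean`: `λ_ext`, the blocks of the externals, and the seven indexed families with their
couplings in the source's basis, spins and blocks) and candidate sector channel sums `S0p, …, S4`: the block
expansion of each sector converges channel by channel at `(u,v)` and at `(v,u)` to its channel sums — with the
signs `ε = (−1)^ℓ` of the charge-`1` and charge-`3` families and the weights `λ²` of the `2⁻, 3, 4` families written
out as in eq. (4point) — and the grouped total channel sums `totalSums` are crossing symmetric in flavour space at
`(u,v)` and `(v,u)`. [cite: ChesterEtAl2020, §2.1 (eq. (4point); "Equating each of these s-channel 4-point functions with their respective t-channels")] -/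
def FlavourCrossingAt (X : O2Data) (S0p S0m S1 S2p S2m S3 S4 : Sec → ℝ → ℝ → ℝ) (u v : ℝ) : Prop :=
  ((∀ σ, HasSum (fun i => sec0p (X.a0 i) (X.b0 i) (X.c0 i) (X.g0p i) σ u v) (S0p σ u v)) ∧
    ∀ σ, HasSum (fun i => sec0p (X.a0 i) (X.b0 i) (X.c0 i) (X.g0p i) σ v u) (S0p σ v u)) ∧
  ((∀ σ, HasSum (fun i => sec0m (X.b0m i) (X.c0m i) (X.g0m i) σ u v) (S0m σ u v)) ∧
    ∀ σ, HasSum (fun i => sec0m (X.b0m i) (X.c0m i) (X.g0m i) σ v u) (S0m σ v u)) ∧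
  ((∀ σ, HasSum (fun i => sec1 (X.x1 i) (X.y1 i) ((-1) ^ X.ℓ1 i) (X.g1 i) σ u v) (S1 σ u v)) ∧
    ∀ σ, HasSum (fun i => sec1 (X.x1 i) (X.y1 i) ((-1) ^ X.ℓ1 i) (X.g1 i) σ v u) (S1 σ v u)) ∧
  ((∀ σ, HasSum (fun i => sec2p (X.b2 i) (X.z2 i) (X.g2p i) σ u v) (S2p σ u v)) ∧
    ∀ σ, HasSum (fun i => sec2p (X.b2 i) (X.z2 i) (X.g2p i) σ v u) (S2p σ v u)) ∧
  ((∀ σ, HasSum (fun i => sec2m (X.lam2m i ^ 2) (X.g2m i) σ u v) (S2m σ u v)) ∧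
    ∀ σ, HasSum (fun i => sec2m (X.lam2m i ^ 2) (X.g2m i) σ v u) (S2m σ v u)) ∧
  ((∀ σ, HasSum (fun i => sec3 (X.lam3 i ^ 2) ((-1) ^ X.ℓ3 i) (X.g3 i) σ u v) (S3 σ u v)) ∧
    ∀ σ, HasSum (fun i => sec3 (X.lam3 i ^ 2) ((-1) ^ X.ℓ3 i) (X.g3 i) σ v u) (S3 σ v u)) ∧
  ((∀ σ, HasSum (fun i => sec4 (X.lam4 i ^ 2) (X.g4 i) σ u v) (S4 σ u v)) ∧
    ∀ σ, HasSum (fun i => sec4 (X.lam4 i ^ 2) (X.g4 i) σ v u) (S4 σ v u)) ∧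
  O2CrossingAt X.D (totalSums X.lam X.gs X.gφ X.gt S0p S0m S1 S2p S2m S3 S4) u v ∧
  O2CrossingAt X.D (totalSums X.lam X.gs X.gφ X.gt S0p S0m S1 S2p S2m S3 S4) v u

/-- **Axiom A3 of `O2ThreeScalarSystem` from flavour-space crossing.**  If at every point
`(u,v) = (z z̄, (1−z)(1−z̄))`, `z, z̄ ∈ (0,1)`, the datum `X` is flavour-crossing symmetric in the sense of
`FlavourCrossingAt` (for some sector channel sums), then `X.SatisfiesCrossing` — the grouped 22-row crossing
equation with the QUOTED vectors, as hypothesised by `SatisfiesO2Axioms` and consumed by `O2Enclosure` /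
`BoxExcluded`. [cite: ChesterEtAl2020, §2.1 (crossing equations)] -/
theorem satisfiesCrossing_of_flavourCrossing (X : O2Data) {S0p S0m S1 S2p S2m S3 S4 : Sec → ℝ → ℝ → ℝ}
    (h : ∀ z zb : ℝ, z ∈ Ioo (0 : ℝ) 1 → zb ∈ Ioo (0 : ℝ) 1 →
      FlavourCrossingAt X S0p S0m S1 S2p S2m S3 S4 (z * zb) ((1 - z) * (1 - zb))) :
    X.SatisfiesCrossing := by
  intro z zb hz hzb
  obtain ⟨h0p, h0m, h1, h2p, h2m, h3, h4, hc, hc'⟩ := h z zb hz hzb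
  obtain ⟨k0p, k0m, k1, k2p, k2m, k3, k4, kx⟩ :=
    crossingEq_of_flavourCrossing (D := X.D) h0p h0m h1 h2p h2m h3 h4 hc hc'
  exact ⟨_, _, _, _, _, _, _, k0p, k0m, k1, k2p, k2m, k3, k4, kx⟩

end System

end Literature.MathematicalPhysics.QuantumFieldTheory.O2CrossingDerivation

end
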